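import Literature.Computability.Complexity.NumProgramsAPScan
import HarnessLib

/-!
# Numeric register programs, VIII b: specification of the arithmetic-progression scan

The assembled specification `apScanP_spec` of the program `apScanP` of
`NumProgramsAPScan.lean` (Harvey 2021, Proposition 2.5, for a general arithmetic progression):
with `d = 2^K`, `found = 1` iff some candidate `s + M k`, `1 ≤ k ≤ d²`, is not coprime to `N`,
and then `kout` is the least such `k`; frame, `peak` and `steps` bounds, and the multiplier's
precondition at every call.

## References

* D. Harvey, *An exponent one-fifth algorithm for deterministic integer factorisation*, Math.
  Comp. 90 (2021), §2.3, Proposition 2.5 [Harvey2021].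
-/

namespace Literature.Computability.Complexity

open _root_.Computability Polynomial

namespace NCom

variable {S V O X E : Type} [DecidableEq S] [DecidableEq V] [DecidableEq O] {𝓔 : NExt S V O X E}

/-- The cost bound of `apScanP` (two product trees, one remainder tree, two scans). [folklore] -/
def apCost (cost : ℕ → ℕ) (N K : ℕ) : ℕ :=
  2 * (300 * (K + 1) * 2 ^ K + treeCostD cost K K) + (10 * 2 ^ K + remCostD cost K K + K + 14) +
    2 ^ K * (20 * N.size + 40) + (6 * K + 60) * 2 ^ K + 100

/-- The peak bound of `apScanP`. [folklore] -/
def apPeakBound (N s Mv K : ℕ) : ℕ := 3 * N + (Mv + 2) * (2 ^ K + 1) * (2 ^ K + 1) + (K + 8) * 2 ^ K + s + 3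

section ApSpec

variable (M : Multiplier 𝓔) (ρ : ApS ↪ S) (ν : ApV ↪ V) (ω : ApO ↪ O)

/-- The standing part of the scan's state: moduli, the constant, and empty work queues and
accumulators of both register banks. [folklore] -/
structure ApInv (N : ℕ) (σ : NState S V O) : Prop where
  hone : σ.sc (ρ .one) = 1
  hptn : σ.sc (ρ (.pt (.pm .n))) = N
  hrmn : σ.sc (ρ (.rm (.dv (.iv (.pm .n))))) = N
  hlvl : σ.vi (ν (.pv .lvl)) = []
  hpA : σ.vi (ν (.pv (.pv .A))) = []
  hpB : σ.vi (ν (.pv (.pv .B))) = []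
  hpF : σ.vi (ν (.pv (.pv .F))) = []
  hpG : σ.vi (ν (.pv (.pv .G))) = []
  hpH : σ.vi (ν (.pv (.pv .H))) = []
  hpC : σ.vi (ν (.pv (.pv .C))) = []
  hpacc : σ.vo (ω (.po .acc)) = []
  hpaccN : σ.vo (ω (.po .accN)) = []
  hpaccT : σ.vo (ω (.po .accT)) = []
  hrT : σ.vi (ν (.rv (.rv .T))) = []
  hrT2 : σ.vi (ν (.rv (.rv .T2))) = []
  hrQ : σ.vi (ν (.rv (.rv .Q))) = []
  hrRB : σ.vi (ν (.rv (.rv (.vv .RB)))) = []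
  hrG : σ.vi (ν (.rv (.rv (.vv .G)))) = []
  hrpA : σ.vi (ν (.rv (.rv (.vv (.pv .A))))) = []
  hrpB : σ.vi (ν (.rv (.rv (.vv (.pv .B))))) = []
  hrpF : σ.vi (ν (.rv (.rv (.vv (.pv .F))))) = []
  hrpG : σ.vi (ν (.rv (.rv (.vv (.pv .G))))) = []
  hrpH : σ.vi (ν (.rv (.rv (.vv (.pv .H))))) = []
  hrpC : σ.vi (ν (.rv (.rv (.vv (.pv .C))))) = []
  hracc : σ.vo (ω (.ro (.ro (.vo .acc)))) = []
  hracc2 : σ.vo (ω (.ro (.ro (.vo .acc2)))) = []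
  hraccL : σ.vo (ω (.ro (.ro (.vo .accL)))) = []
  hraccP : σ.vo (ω (.ro .accP)) = []
  hraccR : σ.vo (ω (.ro (.ro .accR))) = []
  hrDA : σ.vi (ν (.rv (.rv .DA))) = []
  hrDB : σ.vi (ν (.rv (.rv .DB))) = []

omit [DecidableEq S] [DecidableEq V] [DecidableEq O] in
/-- `ApInv` only reads registers, so it survives a `bump`. [folklore] -/
theorem ApInv.bump {N : ℕ} {σ : NState S V O} (h : ApInv ρ ν ω N σ) (a k : ℕ) : ApInv ρ ν ω N (σ.bump a k) := by
  obtain ⟨f1, f2, f3, f4, f5, f6, f7, f8, f9, f10, f11, f12, f13, f14, f15, f16, f17, f18, f19, f20, f21, f22, f23, f24, f25, f26, f27, f28, f29, f30, f31⟩ := h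
  exact ⟨f1, f2, f3, f4, f5, f6, f7, f8, f9, f10, f11, f12, f13, f14, f15, f16, f17, f18, f19, f20, f21, f22, f23, f24, f25, f26, f27, f28, f29, f30, f31⟩

end ApSpec

/-- **The scanned values are the block products**: the remainder tree's output at point `u` is
`∏_{1 ≤ j ≤ d} (s + M (u d + j)) mod N` (`d = 2^K`). [Harvey 2021, proof of Prop. 2.5] [folklore] -/
theorem apValues_getD {N s Mv K u : ℕ} (hN : 1 < N) (hu : u < 2 ^ K) :
    ((List.range (2 ^ K)).map (fun i => ((listPoly N (treeBlock N (apRoots N s Mv (2 ^ K)) K 0)).eval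
      ((((apPoints N Mv (2 ^ K) (2 ^ K)).getD i 0 : ℕ) : ZMod N))).val)).getD u 0 = apBlockProd s Mv (2 ^ K) u % N := by
  have hN0 : 0 < N := by omega
  rw [List.getD_eq_getElem _ _ (by simpa using hu), List.getElem_map, List.getElem_range, listPoly_treeBlock hN, Nat.zero_mul,
    List.drop_zero, List.take_of_length_le (by rw [length_apRoots]), apPoints, List.getD_eq_getElem _ _ (by simpa using hu),
    List.getElem_map, List.getElem_range, eval_apPoly hN0, ZMod.val_natCast]

section ApSpec

variable (M : Multiplier 𝓔) (ρ : ApS ↪ S) (ν : ApV ↪ V) (ω : ApO ↪ O)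


set_option maxHeartbeats 40000000 in
set_option linter.unusedSimpArgs false in -- one uniform simp set drives the symbolic execution of every stage
/-- The state after the two product trees and the remainder tree (stages 0–2 of `apScanP`): the
values `g(v_u) = ∏_j (s + M (u d + j)) mod N` on `REM`, the standing invariant, the inputs, frames,
and the `peak` / `steps` / extension-call bookkeeping with room for the two scans. [folklore] -/
theorem apScanP_pre (σ : NState S V O) (N s Mv K : ℕ) (hN : 1 < N) (hodd : Odd N) (hI : ApInv ρ ν ω N σ)
    (hn : σ.sc (ρ .n) = N) (hs : σ.sc (ρ .s) = s) (hM : σ.sc (ρ .M) = Mv) (hK : σ.sc (ρ .K) = K)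
    (hvals : σ.vi (ν (.pv .vals)) = []) (htree : σ.vi (ν (.pv .tree)) = []) (hREM : σ.vi (ν (.rv .REM)) = []) (hTREE : σ.vi (ν (.rv .TREE)) = [])
    (hGIN : σ.vi (ν (.rv .GIN)) = []) :
    ∃ Y3 : NState S V O, Y3 = ((remtreeP M (ApS.rmE.trans ρ) (ApV.rvE.trans ν) (ApO.roE.trans ω) : NCom S V O E).eval 𝓔 ((apStage2 M ρ ν ω : NCom S V O E).eval 𝓔 ((apStage1 M ρ ν ω : NCom S V O E).eval 𝓔 ((apInit ρ : NCom S V O E).eval 𝓔 σ)))) ∧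
    ApInv ρ ν ω N Y3 ∧
    (Y3).vi (ν (.rv .REM)) = (List.range (2 ^ K)).map (fun i => ((listPoly N (treeBlock N (apRoots N s Mv (2 ^ K)) K 0)).eval
        ((((apPoints N Mv (2 ^ K) (2 ^ K)).getD i 0 : ℕ) : ZMod N))).val) ∧
    (Y3).vi (ν (.rv .TREE)) = [] ∧ (Y3).vi (ν (.rv .GIN)) = [] ∧ (Y3).vi (ν (.pv .vals)) = [] ∧ (Y3).vi (ν (.pv .tree)) = [] ∧
    (Y3).sc (ρ .n) = N ∧ (Y3).sc (ρ .s) = s ∧ (Y3).sc (ρ .M) = Mv ∧ (Y3).sc (ρ .K) = K ∧ (Y3).sc (ρ .d) = 2 ^ K ∧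
    (∀ r, (∀ i, r ≠ ρ i) → (Y3).sc r = σ.sc r) ∧ (∀ w, (∀ i, w ≠ ν i) → (Y3).vi w = σ.vi w) ∧ (∀ p, (∀ i, p ≠ ω i) → (Y3).vo p = σ.vo p) ∧
    (Y3).peak ≤ max σ.peak (apPeakBound N s Mv K) ∧
    (Y3).steps + 2 ^ K * (10 * N.size + 8) + 2 ^ K * (10 * N.size + 12) + 2 * 2 ^ K + 14 ≤ σ.steps + apCost M.cost N K ∧
    ((apInit ρ : NCom S V O E).extOK 𝓔 σ ∧ (apStage1 M ρ ν ω : NCom S V O E).extOK 𝓔 ((apInit ρ : NCom S V O E).eval 𝓔 σ) ∧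
      (apStage2 M ρ ν ω : NCom S V O E).extOK 𝓔 ((apStage1 M ρ ν ω : NCom S V O E).eval 𝓔 ((apInit ρ : NCom S V O E).eval 𝓔 σ)) ∧
      (remtreeP M (ApS.rmE.trans ρ) (ApV.rvE.trans ν) (ApO.roE.trans ω) : NCom S V O E).extOK 𝓔 ((apStage2 M ρ ν ω : NCom S V O E).eval 𝓔 ((apStage1 M ρ ν ω : NCom S V O E).eval 𝓔 ((apInit ρ : NCom S V O E).eval 𝓔 σ)))) := by
  obtain ⟨hone, hptn, hrmn, hlvl, hpA, hpB, hpF, hpG, hpH, hpC, hpacc, hpaccN, hpaccT, hrT, hrT2, hrQ, hrRB, hrG, hrpA, hrpB, hrpF, hrpG, hrpH, hrpC, hracc, hracc2, hraccL, hraccP, hraccR, hrDA, hrDB⟩ := hI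
  have hpow : 1 ≤ 2 ^ K := Nat.one_le_two_pow
  have hN0 : 0 < N := by omega
  have hszN : N.size ≤ N := Nat.size_le.2 Nat.lt_two_pow_self
  have hKD : 2 ^ K ≤ (K + 8) * 2 ^ K := Nat.le_mul_of_pos_left _ (by omega)
  have hKD3 : (K + 3) * 2 ^ K ≤ (K + 8) * 2 ^ K := Nat.mul_le_mul_right _ (by omega)
  have hKD4 : 4 * 2 ^ K ≤ (K + 8) * 2 ^ K := Nat.mul_le_mul_right _ (by omega)
  have hpow2 : 2 ^ (K + 2) = 4 * 2 ^ K := by rw [pow_add]; ring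
  have hMv1 : Mv * 2 ^ K * (2 ^ K + 1) ≤ (Mv + 2) * (2 ^ K + 1) * (2 ^ K + 1) :=
    Nat.mul_le_mul (Nat.mul_le_mul (Nat.le_add_right _ _) (Nat.le_succ _)) le_rfl
  have hMv2 : Mv * 2 ^ K ≤ (Mv + 2) * (2 ^ K + 1) * (2 ^ K + 1) :=
    (Nat.mul_le_mul (Nat.le_add_right _ _) (Nat.le_succ _)).trans (Nat.le_mul_of_pos_right _ (by omega))
  have q1 : ∀ u0, u0 < 2 ^ K → 2 ^ K + u0 * 2 ^ K + Mv * (u0 * 2 ^ K + 2 ^ K) + s ≤ apPeakBound N s Mv K := by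
    intro u0 hu0; clear * - hu0; unfold apPeakBound
    have h1 : u0 * 2 ^ K + 2 ^ K ≤ (2 ^ K + 1) * (2 ^ K + 1) := by nlinarith [Nat.mul_le_mul_right (2 ^ K) (Nat.succ_le_of_lt hu0)]
    have h2 : Mv * (u0 * 2 ^ K + 2 ^ K) ≤ Mv * ((2 ^ K + 1) * (2 ^ K + 1)) := Nat.mul_le_mul_left _ h1
    have h3 : Mv * ((2 ^ K + 1) * (2 ^ K + 1)) + 2 * ((2 ^ K + 1) * (2 ^ K + 1)) = (Mv + 2) * (2 ^ K + 1) * (2 ^ K + 1) := by ring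
    have h4 : 2 ^ K + u0 * 2 ^ K ≤ 2 * ((2 ^ K + 1) * (2 ^ K + 1)) := by nlinarith [h1]
    omega
  have q2 : 2 ^ K + Mv * 2 ^ K * (2 ^ K + 1) ≤ apPeakBound N s Mv K := by unfold apPeakBound; omega
  have q3 : Mv * 2 ^ K + s + 1 ≤ apPeakBound N s Mv K := by unfold apPeakBound; omega
  have q4 : (K + 3) * 2 ^ K ≤ apPeakBound N s Mv K := by unfold apPeakBound; omega
  have q5 : 2 ^ (K + 2) ≤ apPeakBound N s Mv K := by unfold apPeakBound; rw [hpow2]; omega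
  have q6a : 3 * N ≤ apPeakBound N s Mv K := by unfold apPeakBound; omega
  have q6b : 4 * 2 ^ K + 2 ≤ apPeakBound N s Mv K := by unfold apPeakBound; omega
  have q6c : 2 * N.size ≤ apPeakBound N s Mv K := by unfold apPeakBound; omega
  have q6d : K + 3 ≤ apPeakBound N s Mv K := by
    unfold apPeakBound; have : K + 3 ≤ (K + 3) * 2 ^ K := Nat.le_mul_of_pos_right _ hpow
    omega
  -- the sub-states, made opaque
  obtain ⟨X0, hX0⟩ : ∃ X, X = (apInit ρ : NCom S V O E).eval 𝓔 σ := ⟨_, rfl⟩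
  set Y1 := ((setc (ρ .j) 0 ;ₙ times (ρ .d) (apRootsBody ρ ω) ;ₙ pour (ω (ApO.po PTreeO.acc)) (ν (.pv .vals)) ;ₙ mov (ρ (.pt .nv)) (ρ .d) : NCom S V O E)).eval 𝓔 X0 with hY1

  -- stage 0: constants and `d = 2^K`
  set P4 := ((setc (ρ .d) 1 : NCom S V O E)).eval 𝓔 (((mov (ρ (.rm (.dv (.iv (.pm .n))))) (ρ .n) : NCom S V O E)).eval 𝓔
    (((mov (ρ (.pt (.pm .n))) (ρ .n) : NCom S V O E)).eval 𝓔 (((setc (ρ .one) 1 : NCom S V O E)).eval 𝓔 σ))) with hP4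
  have hX0' : X0 = ((add (ρ .d) (ρ .d) (ρ .d) : NCom S V O E).eval 𝓔)^[K] (P4.bump 0 (K + 1)) := by
    rw [hX0]; show ((setc (ρ .one) 1 ;ₙ mov _ _ ;ₙ mov _ _ ;ₙ setc (ρ .d) 1 ;ₙ times (ρ .K) _ : NCom S V O E)).eval 𝓔 σ = _
    rw [eval_seq, eval_seq, eval_seq, eval_seq, eval_times, ← hP4]
    congr 2 <;> simp [hP4, eval, hK]
  obtain ⟨d1, d2, d3, d4, d5, d6⟩ := apDbl_iterate (𝓔 := 𝓔) ρ (P4.bump 0 (K + 1)) K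
  rw [← hX0'] at d1 d2 d3 d4 d5 d6
  simp only [NState.sc_bump, NState.vi_bump, NState.vo_bump, NState.peak_bump, NState.steps_bump, Nat.max_zero] at d1 d2 d3 d4 d5 d6
  have p4d : P4.sc (ρ .d) = 1 := by simp [hP4, eval]
  have p4r : ∀ r : ApS, r ≠ .d → r ≠ .one → r ≠ .pt (.pm .n) → r ≠ .rm (.dv (.iv (.pm .n))) → P4.sc (ρ r) = σ.sc (ρ r) := fun r a b c e => by simp [hP4, eval, a, b, c, e]
  have p4o : ∀ r, (∀ i, r ≠ ρ i) → P4.sc r = σ.sc r := fun r hr => by simp [hP4, eval, hr]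
  have x0d : X0.sc (ρ .d) = 2 ^ K := by rw [d1, p4d, Nat.mul_one]
  have x0r : ∀ r : ApS, r ≠ .d → r ≠ .one → r ≠ .pt (.pm .n) → r ≠ .rm (.dv (.iv (.pm .n))) → X0.sc (ρ r) = σ.sc (ρ r) :=
    fun r a b c e => (d2 _ (by simpa using a)).trans (p4r r a b c e)
  have x0one : X0.sc (ρ .one) = 1 := by rw [d2 _ (by simp)]; simp [hP4, eval]
  have x0ptn : X0.sc (ρ (.pt (.pm .n))) = N := by rw [d2 _ (by simp)]; simp [hP4, eval, hn]
  have x0rmn : X0.sc (ρ (.rm (.dv (.iv (.pm .n))))) = N := by rw [d2 _ (by simp)]; simp [hP4, eval, hn]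
  have x0o : ∀ r, (∀ i, r ≠ ρ i) → X0.sc r = σ.sc r := fun r hr => (d2 _ (hr _)).trans (p4o r hr)
  have x0vi : X0.vi = σ.vi := by rw [d3]; simp [hP4, eval]
  have x0vo : X0.vo = σ.vo := by rw [d4]; simp [hP4, eval]
  have x0pk : X0.peak ≤ max σ.peak (max 1 (2 ^ K)) := by
    refine d5.trans ?_; rw [p4d, Nat.mul_one]; simp only [hP4, eval, NState.peak_bump, NState.peak_setSc, Nat.max_zero]
    clear * -; omega
  have x0st : X0.steps = σ.steps + 2 * K + 5 := by rw [d6]; simp [hP4, eval]; ring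
  have x0n : X0.sc (ρ .n) = N := (x0r .n (by simp) (by simp) (by simp) (by simp)).trans hn
  have x0s : X0.sc (ρ .s) = s := (x0r .s (by simp) (by simp) (by simp) (by simp)).trans hs
  have x0M : X0.sc (ρ .M) = Mv := (x0r .M (by simp) (by simp) (by simp) (by simp)).trans hM
  have x0K : X0.sc (ρ .K) = K := (x0r .K (by simp) (by simp) (by simp) (by simp)).trans hK
  clear_value P4
  clear hX0' d1 d2 d3 d4 d5 d6 p4d p4r p4o hP4

  -- stage 1a: the roots
  set roots := apRoots N s Mv (2 ^ K) with hroots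
  have hrl : roots.length = 2 ^ K := length_apRoots
  have hrN : ∀ x ∈ roots, x < N := fun x hx => lt_of_mem_apRoots hN0 hx
  set J0 := ((setc (ρ .j) 0 : NCom S V O E)).eval 𝓔 X0 with hJ0
  obtain ⟨a1, a2, a3, a4, a5, a6, a7, a8⟩ := apRoots_iterate (𝓔 := 𝓔) ρ ω (J0.bump 0 (2 ^ K + 1)) (by simp [hJ0, eval]) (by simp [hJ0, eval, x0one]) (2 ^ K)
  set RL := ((apRootsBody ρ ω : NCom S V O E).eval 𝓔)^[2 ^ K] (J0.bump 0 (2 ^ K + 1)) with hRL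
  simp only [NState.sc_bump, NState.vi_bump, NState.vo_bump, NState.peak_bump, NState.steps_bump, Nat.max_zero] at a1 a2 a3 a4 a5 a6 a7 a8
  have j0r : ∀ r : ApS, r ≠ .j → J0.sc (ρ r) = X0.sc (ρ r) := fun r hr => by simp [hJ0, eval, hr]
  rw [j0r .n (by simp), j0r .s (by simp), j0r .M (by simp), x0n, x0s, x0M, ← hroots] at a2
  rw [j0r .M (by simp), j0r .s (by simp), x0M, x0s] at a7
  have hY1' : Y1 = ((mov (ρ (.pt .nv)) (ρ .d) : NCom S V O E)).eval 𝓔 (((pour (ω (.po .acc)) (ν (.pv .vals)) : NCom S V O E)).eval 𝓔 RL) := by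
    rw [hY1]; show ((setc (ρ .j) 0 ;ₙ times (ρ .d) _ ;ₙ pour _ _ ;ₙ mov _ _ : NCom S V O E)).eval 𝓔 X0 = _
    rw [eval_seq, eval_seq, eval_seq, eval_times, ← hJ0, j0r .d (by simp), x0d]
  have rlacc : RL.vo (ω (.po .acc)) = roots := by rw [a2]; simp [hJ0, eval, x0vo, hpacc]
  have rlr : ∀ r : ApS, r ≠ .j → r ≠ .tmp → r ≠ .tmp2 → r ≠ .q → RL.sc (ρ r) = X0.sc (ρ r) := fun r b1 b2 b3 b4 => (a3 r b1 b2 b3 b4).trans (j0r r b1)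
  have rlo : ∀ r, (∀ i, r ≠ ρ i) → RL.sc r = σ.sc r := fun r hr => by rw [a4 r hr]; simp [hJ0, eval, hr, x0o r hr]
  have rlvi : RL.vi = σ.vi := by rw [a5]; simp [hJ0, eval, x0vi]
  have rlvo : ∀ p, p ≠ ω (.po .acc) → RL.vo p = σ.vo p := fun p hp => by rw [a6 p hp]; simp [hJ0, eval, x0vo]
  have rlpk : RL.peak ≤ max σ.peak (max (2 ^ K) (Mv * 2 ^ K + s + 1)) := by
    refine a7.trans ?_; simp only [hJ0, eval, NState.peak_bump, NState.peak_setSc, Nat.max_zero]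
    clear * - x0pk; omega
  have rlst : RL.steps = σ.steps + 2 * K + 7 + 2 ^ K + 7 * 2 ^ K := by rw [a8]; simp [hJ0, eval, x0st]; ring
  -- reading `Y1`
  have y1vals : Y1.vi (ν (.pv .vals)) = roots := by rw [hY1']; simp [eval, rlacc, rlvi, hvals]
  have y1acc : Y1.vo (ω (.po .acc)) = [] := by rw [hY1']; simp [eval]
  have y1nv : Y1.sc (ρ (.pt .nv)) = 2 ^ K := by rw [hY1']; simp [eval, rlr .d (by simp) (by simp) (by simp) (by simp), x0d]
  have y1r : ∀ r : ApS, r ≠ .pt .nv → r ≠ .j → r ≠ .tmp → r ≠ .tmp2 → r ≠ .q → Y1.sc (ρ r) = X0.sc (ρ r) := fun r b0 b1 b2 b3 b4 => by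
    rw [hY1']; simp [eval, b0, rlr r b1 b2 b3 b4]
  have y1o : ∀ r, (∀ i, r ≠ ρ i) → Y1.sc r = σ.sc r := fun r hr => by rw [hY1']; simp [eval, hr, rlo r hr]
  have y1vi : ∀ w, w ≠ ν (.pv .vals) → Y1.vi w = σ.vi w := fun w hw => by rw [hY1']; simp [eval, hw, rlvi]
  have y1vo : ∀ p, p ≠ ω (.po .acc) → Y1.vo p = σ.vo p := fun p hp => by rw [hY1']; simp [eval, hp, rlvo p hp]
  have y1pk : Y1.peak ≤ max σ.peak (max (2 ^ K) (Mv * 2 ^ K + s + 1)) := by rw [hY1']; simpa [eval] using rlpk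
  have y1st : Y1.steps = σ.steps + 2 * K + 9 + 9 * 2 ^ K := by rw [hY1']; simp [eval, rlst, rlacc, hrl]; ring
  clear_value J0 RL Y1
  clear a1 a2 a3 a4 a5 a6 a7 a8 j0r hY1' rlacc rlr rlo rlvi rlvo rlpk rlst hRL hJ0
  -- the product tree of the roots
  obtain ⟨K1, hK1a, hK1b, ttree, tK, tP, tnv, tn, tlvl, tvals, tA, tB, tF, tG, tH, tC, tacc, taccN, taccT, tw, tvo, tr, tpk, tst⟩ :=
    ptreeP_spec (𝓔 := 𝓔) M (ApS.ptE.trans ρ) (ApV.pvE.trans ν) (ApO.poE.trans ω) (vals := roots) Y1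
      (by show 1 < Y1.sc (ρ (.pt (.pm .n))); rw [y1r _ (by simp) (by simp) (by simp) (by simp) (by simp), x0ptn]; exact hN)
      (by show Odd (Y1.sc (ρ (.pt (.pm .n)))); rw [y1r _ (by simp) (by simp) (by simp) (by simp) (by simp), x0ptn]; exact hodd)
      y1vals (by show Y1.sc (ρ (.pt .nv)) = roots.length; rw [y1nv, hrl]) (by rw [hrl]; exact hpow)
      (by show ∀ v ∈ roots, v < Y1.sc (ρ (.pt (.pm .n))); rw [y1r _ (by simp) (by simp) (by simp) (by simp) (by simp), x0ptn]; exact hrN)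
      (by show Y1.vi (ν (.pv .lvl)) = []; rw [y1vi _ (by simp)]; exact hlvl) (by show Y1.vi (ν (.pv .tree)) = []; rw [y1vi _ (by simp)]; exact htree)
      (by show Y1.vi (ν (.pv (.pv .A))) = []; rw [y1vi _ (by simp)]; exact hpA) (by show Y1.vi (ν (.pv (.pv .B))) = []; rw [y1vi _ (by simp)]; exact hpB)
      (by show Y1.vi (ν (.pv (.pv .F))) = []; rw [y1vi _ (by simp)]; exact hpF) (by show Y1.vi (ν (.pv (.pv .G))) = []; rw [y1vi _ (by simp)]; exact hpG)
      (by show Y1.vi (ν (.pv (.pv .H))) = []; rw [y1vi _ (by simp)]; exact hpH) (by show Y1.vi (ν (.pv (.pv .C))) = []; rw [y1vi _ (by simp)]; exact hpC)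
      y1acc (by show Y1.vo (ω (.po .accN)) = []; rw [y1vo _ (by simp)]; exact hpaccN) (by show Y1.vo (ω (.po .accT)) = []; rw [y1vo _ (by simp)]; exact hpaccT)
  have text1 := ptreeP_extOK (𝓔 := 𝓔) M (ApS.ptE.trans ρ) (ApV.pvE.trans ν) (ApO.poE.trans ω) (vals := roots) Y1
      (by show 1 < Y1.sc (ρ (.pt (.pm .n))); rw [y1r _ (by simp) (by simp) (by simp) (by simp) (by simp), x0ptn]; exact hN)
      (by show Odd (Y1.sc (ρ (.pt (.pm .n)))); rw [y1r _ (by simp) (by simp) (by simp) (by simp) (by simp), x0ptn]; exact hodd)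
      y1vals (by show Y1.sc (ρ (.pt .nv)) = roots.length; rw [y1nv, hrl]) (by rw [hrl]; exact hpow)
      (by show ∀ v ∈ roots, v < Y1.sc (ρ (.pt (.pm .n))); rw [y1r _ (by simp) (by simp) (by simp) (by simp) (by simp), x0ptn]; exact hrN)
      (by show Y1.vi (ν (.pv .lvl)) = []; rw [y1vi _ (by simp)]; exact hlvl) (by show Y1.vi (ν (.pv .tree)) = []; rw [y1vi _ (by simp)]; exact htree)
      (by show Y1.vi (ν (.pv (.pv .A))) = []; rw [y1vi _ (by simp)]; exact hpA) (by show Y1.vi (ν (.pv (.pv .B))) = []; rw [y1vi _ (by simp)]; exact hpB)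
      (by show Y1.vi (ν (.pv (.pv .F))) = []; rw [y1vi _ (by simp)]; exact hpF) (by show Y1.vi (ν (.pv (.pv .G))) = []; rw [y1vi _ (by simp)]; exact hpG)
      (by show Y1.vi (ν (.pv (.pv .H))) = []; rw [y1vi _ (by simp)]; exact hpH) (by show Y1.vi (ν (.pv (.pv .C))) = []; rw [y1vi _ (by simp)]; exact hpC)
      y1acc (by show Y1.vo (ω (.po .accN)) = []; rw [y1vo _ (by simp)]; exact hpaccN) (by show Y1.vo (ω (.po .accT)) = []; rw [y1vo _ (by simp)]; exact hpaccT)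
  have hKK : K1 = K := by
    rw [hrl] at hK1a hK1b
    have h1 := (Nat.pow_le_pow_iff_right (show 1 < 2 by norm_num)).1 hK1a
    have h2 : 2 ^ K1 < 2 ^ (K + 1) := by rw [pow_succ]; omega
    have h3 := (Nat.pow_lt_pow_iff_right (show 1 < 2 by norm_num)).1 h2
    omega
  simp only [hKK] at hK1a hK1b ttree tK tP tpk tst
  clear hKK K1
  set Z1 := (ptreeP M (ApS.ptE.trans ρ) (ApV.pvE.trans ν) (ApO.poE.trans ω) : NCom S V O E).eval 𝓔 Y1 with hZ1
  simp only [Function.Embedding.trans_apply, ApS.ptE_apply, ApV.pvE_apply, ApO.poE_apply] at ttree tK tP tnv tn tlvl tvals tA tB tF tG tH tC tacc taccN taccT tw tvo tr tpk tst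
  rw [hrl, Nat.sub_self, List.replicate_zero, List.append_nil, y1r _ (by simp) (by simp) (by simp) (by simp) (by simp), x0ptn] at ttree
  rw [y1r _ (by simp) (by simp) (by simp) (by simp) (by simp), x0ptn] at tpk tn
  rw [y1st] at tst
  clear_value Z1

  -- stage 1b: the coefficient list of `g` to `GIN`
  have htl : (treeAcc N roots K (K + 1)).length = (K + 3) * 2 ^ K - 1 := length_treeAcc_full roots K
  have htl' : 2 ^ K + 1 ≤ (treeAcc N roots K (K + 1)).length := by
    rw [htl]; have : (K + 3) * 2 ^ K = K * 2 ^ K + 3 * 2 ^ K := by ring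
    omega
  have htsplit : treeAcc N roots K (K + 1) = treeBlock N roots K 0 ++ treeAcc N roots K K := by
    rw [treeAcc, Nat.sub_self, pow_zero, show blocksFrom N roots K 0 1 = treeBlock N roots K 0 ++ [] from blocksFrom_succ roots K 0 0, List.append_nil]
  have httake : (treeAcc N roots K (K + 1)).take (2 ^ K + 1) = treeBlock N roots K 0 := by
    rw [htsplit, List.take_append_of_le_length (by simp), List.take_of_length_le (by simp)]
  set GIN := treeBlock N roots K 0 with hGINdef
  have hGl : GIN.length = 2 ^ K + 1 := length_treeBlock _ _ _
  have zv : ∀ w : ApV, (∀ i, w ≠ .pv i) → Z1.vi (ν w) = Y1.vi (ν w) := fun w hw => tw _ (fun i => by simpa using hw i)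
  have zo : ∀ p : ApO, (∀ i, p ≠ .po i) → Z1.vo (ω p) = Y1.vo (ω p) := fun p hp => tvo _ (fun i => by simpa using hp i)
  have zs : ∀ r : ApS, (∀ i, r ≠ .pt i) → Z1.sc (ρ r) = Y1.sc (ρ r) := fun r hr => tr _ (fun i => by simpa using hr i)
  have z1d : Z1.sc (ρ .d) = 2 ^ K := by rw [zs .d (by simp), y1r .d (by simp) (by simp) (by simp) (by simp) (by simp), x0d]
  have z1one : Z1.sc (ρ .one) = 1 := by rw [zs .one (by simp), y1r .one (by simp) (by simp) (by simp) (by simp) (by simp), x0one]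
  set X1 := ((add (ρ .cnt) (ρ .d) (ρ .one) ;ₙ moveN (ν (.pv .tree)) (ω (.po .acc)) (ρ (.pt (.pm .x))) (ρ .cnt) ;ₙ pour (ω (.po .acc)) (ν (.rv .GIN)) ;ₙ
    clearV (ν (.pv .tree)) : NCom S V O E)).eval 𝓔 Z1 with hX1
  have hX1s : X1 = ((apStage1 M ρ ν ω : NCom S V O E)).eval 𝓔 X0 := by
    rw [hX1, hZ1, hY1]; simp only [apStage1, eval_seq]
  have hGIN1 : Y1.vi (ν (.rv .GIN)) = [] := by rw [y1vi _ (by simp)]; exact hGIN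
  have nX1 := hX1
  simp only [eval_seq, eval, moveN_eq' 𝓔, ttree, tacc, z1d, z1one, htl', httake, zv (.rv .GIN) (by simp), hGIN1, NState.sc_bump, NState.sc_setSc, NState.sc_setVi, NState.sc_setVo, NState.vi_bump,
      NState.vi_setSc, NState.vi_setVi, NState.vi_setVo, NState.vo_bump, NState.vo_setSc, NState.vo_setVi, NState.vo_setVo,
      NState.steps_bump, NState.steps_setSc, NState.steps_setVi, NState.steps_setVo, NState.peak_bump, NState.peak_setSc, NState.peak_setVi,
      NState.peak_setVo, Function.update_apply, EmbeddingLike.apply_eq_iff_eq, reduceCtorEq, ApS.pt.injEq, ApS.rm.injEq, ApS.gc.injEq,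
      ApV.pv.injEq, ApV.rv.injEq, ApO.po.injEq, ApO.ro.injEq, PTreeS.pm.injEq, PTreeV.pv.injEq, RemS.dv.injEq, RemV.rv.injEq, RemO.ro.injEq,
      DivS.iv.injEq, DivV.vv.injEq, DivO.vo.injEq, InvS.pm.injEq, InvV.pv.injEq, InvS.ln.injEq,
      ite_true, ite_false, not_false_eq_true, implies_true, Nat.max_zero, Nat.zero_max, Nat.le_add_right,
      List.take_length, List.drop_length, List.nil_append, List.append_nil, le_refl, List.take_append_drop, List.length_nil, List.length_append,
      List.length_take, length_apRoots, length_apPoints] at nX1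
  have z1n : Z1.sc (ρ .n) = N := (zs .n (by simp)).trans ((y1r .n (by simp) (by simp) (by simp) (by simp) (by simp)).trans x0n)
  have z1s : Z1.sc (ρ .s) = s := (zs .s (by simp)).trans ((y1r .s (by simp) (by simp) (by simp) (by simp) (by simp)).trans x0s)
  have z1M : Z1.sc (ρ .M) = Mv := (zs .M (by simp)).trans ((y1r .M (by simp) (by simp) (by simp) (by simp) (by simp)).trans x0M)
  have z1K : Z1.sc (ρ .K) = K := (zs .K (by simp)).trans ((y1r .K (by simp) (by simp) (by simp) (by simp) (by simp)).trans x0K)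
  have z1rmn : Z1.sc (ρ (.rm (.dv (.iv (.pm .n))))) = N := (zs _ (by simp)).trans ((y1r _ (by simp) (by simp) (by simp) (by simp) (by simp)).trans x0rmn)
  have z1rs : ∀ j : RemS, j ≠ .dv (.iv (.pm .n)) → Z1.sc (ρ (.rm j)) = σ.sc (ρ (.rm j)) := fun j hj =>
    (zs _ (by simp)).trans ((y1r _ (by simp) (by simp) (by simp) (by simp) (by simp)).trans (x0r _ (by simp) (by simp) (by simp) (by simp [hj])))
  have z1gs : ∀ j : GcdR, Z1.sc (ρ (.gc j)) = σ.sc (ρ (.gc j)) := fun j =>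
    (zs _ (by simp)).trans ((y1r _ (by simp) (by simp) (by simp) (by simp) (by simp)).trans (x0r _ (by simp) (by simp) (by simp) (by simp)))
  have z1rv : ∀ j : RemV, Z1.vi (ν (.rv j)) = σ.vi (ν (.rv j)) := fun j => (zv _ (by simp)).trans (y1vi _ (by simp))
  have z1ro : ∀ j : RemO, Z1.vo (ω (.ro j)) = σ.vo (ω (.ro j)) := fun j => (zo _ (by simp)).trans (y1vo _ (by simp))
  have z1o : ∀ r, (∀ i, r ≠ ρ i) → Z1.sc r = σ.sc r := fun r hr => (tr r (fun i => hr _)).trans (y1o r hr)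
  have z1w : ∀ w, (∀ i, w ≠ ν i) → Z1.vi w = σ.vi w := fun w hw => (tw w (fun i => hw _)).trans (y1vi w (hw _))
  have z1p : ∀ p, (∀ i, p ≠ ω i) → Z1.vo p = σ.vo p := fun p hp => (tvo p (fun i => hp _)).trans (y1vo p (hp _))
  obtain ⟨bGIN, btree, bacc, bvals, blvl, bpA, bpB, bpF, bpG, bpH, bpC, baccN, baccT, bptn, bd, bone, bn', bs', bM', bK', brmn⟩ :
      X1.vi (ν (.rv .GIN)) = GIN ∧ X1.vi (ν (.pv .tree)) = [] ∧ X1.vo (ω (.po .acc)) = [] ∧ X1.vi (ν (.pv .vals)) = [] ∧ X1.vi (ν (.pv .lvl)) = [] ∧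
      X1.vi (ν (.pv (.pv .A))) = [] ∧ X1.vi (ν (.pv (.pv .B))) = [] ∧ X1.vi (ν (.pv (.pv .F))) = [] ∧ X1.vi (ν (.pv (.pv .G))) = [] ∧
      X1.vi (ν (.pv (.pv .H))) = [] ∧ X1.vi (ν (.pv (.pv .C))) = [] ∧ X1.vo (ω (.po .accN)) = [] ∧ X1.vo (ω (.po .accT)) = [] ∧
      X1.sc (ρ (.pt (.pm .n))) = N ∧ X1.sc (ρ .d) = 2 ^ K ∧ X1.sc (ρ .one) = 1 ∧ X1.sc (ρ .n) = N ∧ X1.sc (ρ .s) = s ∧ X1.sc (ρ .M) = Mv ∧ X1.sc (ρ .K) = K ∧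
      X1.sc (ρ (.rm (.dv (.iv (.pm .n))))) = N := by
    rw [nX1]; simp only [tvals, tlvl, tA, tB, tF, tG, tH, tC, taccN, taccT, tn, z1d, z1one, z1n, z1s, z1M, z1K, z1rmn, htsplit, NState.sc_bump, NState.sc_setSc, NState.sc_setVi, NState.sc_setVo, NState.vi_bump,
      NState.vi_setSc, NState.vi_setVi, NState.vi_setVo, NState.vo_bump, NState.vo_setSc, NState.vo_setVi, NState.vo_setVo,
      NState.steps_bump, NState.steps_setSc, NState.steps_setVi, NState.steps_setVo, NState.peak_bump, NState.peak_setSc, NState.peak_setVi,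
      NState.peak_setVo, Function.update_apply, EmbeddingLike.apply_eq_iff_eq, reduceCtorEq, ApS.pt.injEq, ApS.rm.injEq, ApS.gc.injEq,
      ApV.pv.injEq, ApV.rv.injEq, ApO.po.injEq, ApO.ro.injEq, PTreeS.pm.injEq, PTreeV.pv.injEq, RemS.dv.injEq, RemV.rv.injEq, RemO.ro.injEq,
      DivS.iv.injEq, DivV.vv.injEq, DivO.vo.injEq, InvS.pm.injEq, InvV.pv.injEq, InvS.ln.injEq,
      ite_true, ite_false, not_false_eq_true, implies_true, Nat.max_zero, Nat.zero_max, Nat.le_add_right,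
      List.take_length, List.drop_length, List.nil_append, List.append_nil, le_refl, List.take_append_drop, List.length_nil, List.length_append,
      List.length_take, length_apRoots, length_apPoints, and_self, and_true, true_and,
      List.drop_append_of_le_length, length_treeBlock, List.drop_of_length_le]
  have b_rs : ∀ j : RemS, j ≠ .dv (.iv (.pm .n)) → X1.sc (ρ (.rm j)) = σ.sc (ρ (.rm j)) := fun j hj => by rw [← z1rs j hj, nX1]; simp only [NState.sc_bump, NState.sc_setSc, NState.sc_setVi, NState.sc_setVo, NState.vi_bump,
      NState.vi_setSc, NState.vi_setVi, NState.vi_setVo, NState.vo_bump, NState.vo_setSc, NState.vo_setVi, NState.vo_setVo,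
      NState.steps_bump, NState.steps_setSc, NState.steps_setVi, NState.steps_setVo, NState.peak_bump, NState.peak_setSc, NState.peak_setVi,
      NState.peak_setVo, Function.update_apply, EmbeddingLike.apply_eq_iff_eq, reduceCtorEq, ApS.pt.injEq, ApS.rm.injEq, ApS.gc.injEq,
      ApV.pv.injEq, ApV.rv.injEq, ApO.po.injEq, ApO.ro.injEq, PTreeS.pm.injEq, PTreeV.pv.injEq, RemS.dv.injEq, RemV.rv.injEq, RemO.ro.injEq,
      DivS.iv.injEq, DivV.vv.injEq, DivO.vo.injEq, InvS.pm.injEq, InvV.pv.injEq, InvS.ln.injEq,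
      ite_true, ite_false, not_false_eq_true, implies_true, Nat.max_zero, Nat.zero_max, Nat.le_add_right,
      List.take_length, List.drop_length, List.nil_append, List.append_nil, le_refl, List.take_append_drop, List.length_nil, List.length_append,
      List.length_take, length_apRoots, length_apPoints]
  have b_gs : ∀ j : GcdR, X1.sc (ρ (.gc j)) = σ.sc (ρ (.gc j)) := fun j => by rw [← z1gs j, nX1]; simp only [NState.sc_bump, NState.sc_setSc, NState.sc_setVi, NState.sc_setVo, NState.vi_bump,
      NState.vi_setSc, NState.vi_setVi, NState.vi_setVo, NState.vo_bump, NState.vo_setSc, NState.vo_setVi, NState.vo_setVo,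
      NState.steps_bump, NState.steps_setSc, NState.steps_setVi, NState.steps_setVo, NState.peak_bump, NState.peak_setSc, NState.peak_setVi,
      NState.peak_setVo, Function.update_apply, EmbeddingLike.apply_eq_iff_eq, reduceCtorEq, ApS.pt.injEq, ApS.rm.injEq, ApS.gc.injEq,
      ApV.pv.injEq, ApV.rv.injEq, ApO.po.injEq, ApO.ro.injEq, PTreeS.pm.injEq, PTreeV.pv.injEq, RemS.dv.injEq, RemV.rv.injEq, RemO.ro.injEq,
      DivS.iv.injEq, DivV.vv.injEq, DivO.vo.injEq, InvS.pm.injEq, InvV.pv.injEq, InvS.ln.injEq,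
      ite_true, ite_false, not_false_eq_true, implies_true, Nat.max_zero, Nat.zero_max, Nat.le_add_right,
      List.take_length, List.drop_length, List.nil_append, List.append_nil, le_refl, List.take_append_drop, List.length_nil, List.length_append,
      List.length_take, length_apRoots, length_apPoints]
  have b_rv : ∀ j : RemV, j ≠ .GIN → X1.vi (ν (.rv j)) = σ.vi (ν (.rv j)) := fun j hj => by rw [← z1rv j, nX1]; simp only [hj, NState.sc_bump, NState.sc_setSc, NState.sc_setVi, NState.sc_setVo, NState.vi_bump,
      NState.vi_setSc, NState.vi_setVi, NState.vi_setVo, NState.vo_bump, NState.vo_setSc, NState.vo_setVi, NState.vo_setVo,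
      NState.steps_bump, NState.steps_setSc, NState.steps_setVi, NState.steps_setVo, NState.peak_bump, NState.peak_setSc, NState.peak_setVi,
      NState.peak_setVo, Function.update_apply, EmbeddingLike.apply_eq_iff_eq, reduceCtorEq, ApS.pt.injEq, ApS.rm.injEq, ApS.gc.injEq,
      ApV.pv.injEq, ApV.rv.injEq, ApO.po.injEq, ApO.ro.injEq, PTreeS.pm.injEq, PTreeV.pv.injEq, RemS.dv.injEq, RemV.rv.injEq, RemO.ro.injEq,
      DivS.iv.injEq, DivV.vv.injEq, DivO.vo.injEq, InvS.pm.injEq, InvV.pv.injEq, InvS.ln.injEq,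
      ite_true, ite_false, not_false_eq_true, implies_true, Nat.max_zero, Nat.zero_max, Nat.le_add_right,
      List.take_length, List.drop_length, List.nil_append, List.append_nil, le_refl, List.take_append_drop, List.length_nil, List.length_append,
      List.length_take, length_apRoots, length_apPoints]
  have b_ro : ∀ j : RemO, X1.vo (ω (.ro j)) = σ.vo (ω (.ro j)) := fun j => by rw [← z1ro j, nX1]; simp only [NState.sc_bump, NState.sc_setSc, NState.sc_setVi, NState.sc_setVo, NState.vi_bump,
      NState.vi_setSc, NState.vi_setVi, NState.vi_setVo, NState.vo_bump, NState.vo_setSc, NState.vo_setVi, NState.vo_setVo,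
      NState.steps_bump, NState.steps_setSc, NState.steps_setVi, NState.steps_setVo, NState.peak_bump, NState.peak_setSc, NState.peak_setVi,
      NState.peak_setVo, Function.update_apply, EmbeddingLike.apply_eq_iff_eq, reduceCtorEq, ApS.pt.injEq, ApS.rm.injEq, ApS.gc.injEq,
      ApV.pv.injEq, ApV.rv.injEq, ApO.po.injEq, ApO.ro.injEq, PTreeS.pm.injEq, PTreeV.pv.injEq, RemS.dv.injEq, RemV.rv.injEq, RemO.ro.injEq,
      DivS.iv.injEq, DivV.vv.injEq, DivO.vo.injEq, InvS.pm.injEq, InvV.pv.injEq, InvS.ln.injEq,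
      ite_true, ite_false, not_false_eq_true, implies_true, Nat.max_zero, Nat.zero_max, Nat.le_add_right,
      List.take_length, List.drop_length, List.nil_append, List.append_nil, le_refl, List.take_append_drop, List.length_nil, List.length_append,
      List.length_take, length_apRoots, length_apPoints]
  have b_o : ∀ r, (∀ i, r ≠ ρ i) → X1.sc r = σ.sc r := fun r hr => by rw [← z1o r hr, nX1]; simp only [hr, NState.sc_bump, NState.sc_setSc, NState.sc_setVi, NState.sc_setVo, NState.vi_bump,
      NState.vi_setSc, NState.vi_setVi, NState.vi_setVo, NState.vo_bump, NState.vo_setSc, NState.vo_setVi, NState.vo_setVo,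
      NState.steps_bump, NState.steps_setSc, NState.steps_setVi, NState.steps_setVo, NState.peak_bump, NState.peak_setSc, NState.peak_setVi,
      NState.peak_setVo, Function.update_apply, EmbeddingLike.apply_eq_iff_eq, reduceCtorEq, ApS.pt.injEq, ApS.rm.injEq, ApS.gc.injEq,
      ApV.pv.injEq, ApV.rv.injEq, ApO.po.injEq, ApO.ro.injEq, PTreeS.pm.injEq, PTreeV.pv.injEq, RemS.dv.injEq, RemV.rv.injEq, RemO.ro.injEq,
      DivS.iv.injEq, DivV.vv.injEq, DivO.vo.injEq, InvS.pm.injEq, InvV.pv.injEq, InvS.ln.injEq,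
      ite_true, ite_false, not_false_eq_true, implies_true, Nat.max_zero, Nat.zero_max, Nat.le_add_right,
      List.take_length, List.drop_length, List.nil_append, List.append_nil, le_refl, List.take_append_drop, List.length_nil, List.length_append,
      List.length_take, length_apRoots, length_apPoints]
  have b_w : ∀ w, (∀ i, w ≠ ν i) → X1.vi w = σ.vi w := fun w hw => by rw [← z1w w hw, nX1]; simp only [hw, NState.sc_bump, NState.sc_setSc, NState.sc_setVi, NState.sc_setVo, NState.vi_bump,
      NState.vi_setSc, NState.vi_setVi, NState.vi_setVo, NState.vo_bump, NState.vo_setSc, NState.vo_setVi, NState.vo_setVo,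
      NState.steps_bump, NState.steps_setSc, NState.steps_setVi, NState.steps_setVo, NState.peak_bump, NState.peak_setSc, NState.peak_setVi,
      NState.peak_setVo, Function.update_apply, EmbeddingLike.apply_eq_iff_eq, reduceCtorEq, ApS.pt.injEq, ApS.rm.injEq, ApS.gc.injEq,
      ApV.pv.injEq, ApV.rv.injEq, ApO.po.injEq, ApO.ro.injEq, PTreeS.pm.injEq, PTreeV.pv.injEq, RemS.dv.injEq, RemV.rv.injEq, RemO.ro.injEq,
      DivS.iv.injEq, DivV.vv.injEq, DivO.vo.injEq, InvS.pm.injEq, InvV.pv.injEq, InvS.ln.injEq,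
      ite_true, ite_false, not_false_eq_true, implies_true, Nat.max_zero, Nat.zero_max, Nat.le_add_right,
      List.take_length, List.drop_length, List.nil_append, List.append_nil, le_refl, List.take_append_drop, List.length_nil, List.length_append,
      List.length_take, length_apRoots, length_apPoints]
  have b_p : ∀ p, (∀ i, p ≠ ω i) → X1.vo p = σ.vo p := fun p hp => by rw [← z1p p hp, nX1]; simp only [hp, NState.sc_bump, NState.sc_setSc, NState.sc_setVi, NState.sc_setVo, NState.vi_bump,
      NState.vi_setSc, NState.vi_setVi, NState.vi_setVo, NState.vo_bump, NState.vo_setSc, NState.vo_setVi, NState.vo_setVo,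
      NState.steps_bump, NState.steps_setSc, NState.steps_setVi, NState.steps_setVo, NState.peak_bump, NState.peak_setSc, NState.peak_setVi,
      NState.peak_setVo, Function.update_apply, EmbeddingLike.apply_eq_iff_eq, reduceCtorEq, ApS.pt.injEq, ApS.rm.injEq, ApS.gc.injEq,
      ApV.pv.injEq, ApV.rv.injEq, ApO.po.injEq, ApO.ro.injEq, PTreeS.pm.injEq, PTreeV.pv.injEq, RemS.dv.injEq, RemV.rv.injEq, RemO.ro.injEq,
      DivS.iv.injEq, DivV.vv.injEq, DivO.vo.injEq, InvS.pm.injEq, InvV.pv.injEq, InvS.ln.injEq,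
      ite_true, ite_false, not_false_eq_true, implies_true, Nat.max_zero, Nat.zero_max, Nat.le_add_right,
      List.take_length, List.drop_length, List.nil_append, List.append_nil, le_refl, List.take_append_drop, List.length_nil, List.length_append,
      List.length_take, length_apRoots, length_apPoints]
  have bpk : X1.peak = max Z1.peak (2 ^ K + 1) := by rw [nX1]; simp only [NState.sc_bump, NState.sc_setSc, NState.sc_setVi, NState.sc_setVo, NState.vi_bump,
      NState.vi_setSc, NState.vi_setVi, NState.vi_setVo, NState.vo_bump, NState.vo_setSc, NState.vo_setVi, NState.vo_setVo,
      NState.steps_bump, NState.steps_setSc, NState.steps_setVi, NState.steps_setVo, NState.peak_bump, NState.peak_setSc, NState.peak_setVi,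
      NState.peak_setVo, Function.update_apply, EmbeddingLike.apply_eq_iff_eq, reduceCtorEq, ApS.pt.injEq, ApS.rm.injEq, ApS.gc.injEq,
      ApV.pv.injEq, ApV.rv.injEq, ApO.po.injEq, ApO.ro.injEq, PTreeS.pm.injEq, PTreeV.pv.injEq, RemS.dv.injEq, RemV.rv.injEq, RemO.ro.injEq,
      DivS.iv.injEq, DivV.vv.injEq, DivO.vo.injEq, InvS.pm.injEq, InvV.pv.injEq, InvS.ln.injEq,
      ite_true, ite_false, not_false_eq_true, implies_true, Nat.max_zero, Nat.zero_max, Nat.le_add_right,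
      List.take_length, List.drop_length, List.nil_append, List.append_nil, le_refl, List.take_append_drop, List.length_nil, List.length_append,
      List.length_take, length_apRoots, length_apPoints]
  have bst : X1.steps ≤ Z1.steps + (K + 7) * 2 ^ K + 10 := by
    rw [nX1]; simp only [NState.sc_bump, NState.sc_setSc, NState.sc_setVi, NState.sc_setVo, NState.vi_bump,
      NState.vi_setSc, NState.vi_setVi, NState.vi_setVo, NState.vo_bump, NState.vo_setSc, NState.vo_setVi, NState.vo_setVo,
      NState.steps_bump, NState.steps_setSc, NState.steps_setVi, NState.steps_setVo, NState.peak_bump, NState.peak_setSc, NState.peak_setVi,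
      NState.peak_setVo, Function.update_apply, EmbeddingLike.apply_eq_iff_eq, reduceCtorEq, ApS.pt.injEq, ApS.rm.injEq, ApS.gc.injEq,
      ApV.pv.injEq, ApV.rv.injEq, ApO.po.injEq, ApO.ro.injEq, PTreeS.pm.injEq, PTreeV.pv.injEq, RemS.dv.injEq, RemV.rv.injEq, RemO.ro.injEq,
      DivS.iv.injEq, DivV.vv.injEq, DivO.vo.injEq, InvS.pm.injEq, InvV.pv.injEq, InvS.ln.injEq,
      ite_true, ite_false, not_false_eq_true, implies_true, Nat.max_zero, Nat.zero_max, Nat.le_add_right,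
      List.take_length, List.drop_length, List.nil_append, List.append_nil, le_refl, List.take_append_drop, List.length_nil, List.length_append,
      List.length_take, length_apRoots, length_apPoints, List.length_drop, htl, hGl]
    have : (K + 3) * 2 ^ K = K * 2 ^ K + 3 * 2 ^ K := by ring
    have h2 : (K + 7) * 2 ^ K = K * 2 ^ K + 7 * 2 ^ K := by ring
    clear * - this h2 hpow; omega
  clear_value X1
  clear nX1 hX1

  -- stage 2a: the points
  set pts := apPoints N Mv (2 ^ K) (2 ^ K) with hpts
  have hpl : pts.length = 2 ^ K := length_apPoints _
  have hpN : ∀ x ∈ pts, x < N := fun x hx => lt_of_mem_apPoints hN0 hx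
  set U0 := ((setc (ρ .u) 0 : NCom S V O E)).eval 𝓔 X1 with hU0
  obtain ⟨a1, a2, a3, a4, a5, a6, a7, a8⟩ := apPoints_iterate (𝓔 := 𝓔) ρ ω (U0.bump 0 (2 ^ K + 1)) (by simp [hU0, eval]) (by simp [hU0, eval, bone]) (2 ^ K)
  set PL := ((apPointsBody ρ ω : NCom S V O E).eval 𝓔)^[2 ^ K] (U0.bump 0 (2 ^ K + 1)) with hPL
  simp only [NState.sc_bump, NState.vi_bump, NState.vo_bump, NState.peak_bump, NState.steps_bump, Nat.max_zero] at a1 a2 a3 a4 a5 a6 a7 a8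
  have u0r : ∀ r : ApS, r ≠ .u → U0.sc (ρ r) = X1.sc (ρ r) := fun r hr => by simp [hU0, eval, hr]
  rw [u0r .n (by simp), u0r .M (by simp), u0r .d (by simp), bn', bM', bd, ← hpts] at a2
  rw [u0r .M (by simp), u0r .d (by simp), bM', bd] at a7
  set Y2 := ((setc (ρ .u) 0 ;ₙ times (ρ .d) (apPointsBody ρ ω) ;ₙ pour (ω (.po .acc)) (ν (.pv .vals)) ;ₙ mov (ρ (.pt .nv)) (ρ .d) : NCom S V O E)).eval 𝓔 X1 with hY2
  have hY2' : Y2 = ((mov (ρ (.pt .nv)) (ρ .d) : NCom S V O E)).eval 𝓔 (((pour (ω (.po .acc)) (ν (.pv .vals)) : NCom S V O E)).eval 𝓔 PL) := by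
    rw [hY2]; show ((setc (ρ .u) 0 ;ₙ times (ρ .d) _ ;ₙ pour _ _ ;ₙ mov _ _ : NCom S V O E)).eval 𝓔 X1 = _
    rw [eval_seq, eval_seq, eval_seq, eval_times, ← hU0, u0r .d (by simp), bd]
  have placc : PL.vo (ω (.po .acc)) = pts := by rw [a2]; simp [hU0, eval, bacc]
  have plr : ∀ r : ApS, r ≠ .u → r ≠ .tmp → r ≠ .tmp2 → r ≠ .q → PL.sc (ρ r) = X1.sc (ρ r) := fun r c1 c2 c3 c4 => (a3 r c1 c2 c3 c4).trans (u0r r c1)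
  have plo : ∀ r, (∀ i, r ≠ ρ i) → PL.sc r = σ.sc r := fun r hr => by rw [a4 r hr]; simp [hU0, eval, hr, b_o r hr]
  have plvi : PL.vi = X1.vi := by rw [a5]; simp [hU0, eval]
  have plvo : ∀ p, p ≠ ω (.po .acc) → PL.vo p = X1.vo p := fun p hp => by rw [a6 p hp]; simp [hU0, eval]
  have plpk : PL.peak ≤ max X1.peak (2 ^ K + Mv * 2 ^ K * (2 ^ K + 1)) := by refine a7.trans ?_; simp [hU0, eval]
  have plst : PL.steps = X1.steps + 2 + 2 ^ K + 5 * 2 ^ K := by rw [a8]; simp [hU0, eval]; ring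
  have c1vals : Y2.vi (ν (.pv .vals)) = pts := by rw [hY2']; simp [eval, placc, plvi, bvals]
  have c1acc : Y2.vo (ω (.po .acc)) = [] := by rw [hY2']; simp [eval]
  have c1nv : Y2.sc (ρ (.pt .nv)) = 2 ^ K := by rw [hY2']; simp [eval, plr .d (by simp) (by simp) (by simp) (by simp), bd]
  have c1r : ∀ r : ApS, r ≠ .pt .nv → r ≠ .u → r ≠ .tmp → r ≠ .tmp2 → r ≠ .q → Y2.sc (ρ r) = X1.sc (ρ r) := fun r c0 c1 c2 c3 c4 => by
    rw [hY2']; simp [eval, c0, plr r c1 c2 c3 c4]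
  have c1o : ∀ r, (∀ i, r ≠ ρ i) → Y2.sc r = σ.sc r := fun r hr => by rw [hY2']; simp [eval, hr, plo r hr]
  have c1vi : ∀ w, w ≠ ν (.pv .vals) → Y2.vi w = X1.vi w := fun w hw => by rw [hY2']; simp [eval, hw, plvi]
  have c1vo : ∀ p, p ≠ ω (.po .acc) → Y2.vo p = X1.vo p := fun p hp => by rw [hY2']; simp [eval, hp, plvo p hp]
  have c1pk : Y2.peak ≤ max X1.peak (2 ^ K + Mv * 2 ^ K * (2 ^ K + 1)) := by rw [hY2']; simpa [eval] using plpk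
  have c1st : Y2.steps = X1.steps + 7 * 2 ^ K + 4 := by rw [hY2']; simp [eval, plst, placc, hpl]; ring
  clear_value U0 PL Y2
  clear a1 a2 a3 a4 a5 a6 a7 a8 u0r hY2' placc plr plo plvi plvo plpk plst hPL hU0
  -- the product tree of the points
  obtain ⟨K2, hK2a, hK2b, ttree2, tK2, tP2, tnv2, tn2, tlvl2, tvals2, tA2, tB2, tF2, tG2, tH2, tC2, tacc2, taccN2, taccT2, tw2, tvo2, tr2, tpk2, tst2⟩ :=
    ptreeP_spec (𝓔 := 𝓔) M (ApS.ptE.trans ρ) (ApV.pvE.trans ν) (ApO.poE.trans ω) (vals := pts) Y2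
      (by show 1 < Y2.sc (ρ (.pt (.pm .n))); rw [c1r _ (by simp) (by simp) (by simp) (by simp) (by simp), bptn]; exact hN)
      (by show Odd (Y2.sc (ρ (.pt (.pm .n)))); rw [c1r _ (by simp) (by simp) (by simp) (by simp) (by simp), bptn]; exact hodd)
      c1vals (by show Y2.sc (ρ (.pt .nv)) = pts.length; rw [c1nv, hpl]) (by rw [hpl]; exact hpow)
      (by show ∀ v ∈ pts, v < Y2.sc (ρ (.pt (.pm .n))); rw [c1r _ (by simp) (by simp) (by simp) (by simp) (by simp), bptn]; exact hpN)
      (by show Y2.vi (ν (.pv .lvl)) = []; rw [c1vi _ (by simp)]; exact blvl) (by show Y2.vi (ν (.pv .tree)) = []; rw [c1vi _ (by simp)]; exact btree)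
      (by show Y2.vi (ν (.pv (.pv .A))) = []; rw [c1vi _ (by simp)]; exact bpA) (by show Y2.vi (ν (.pv (.pv .B))) = []; rw [c1vi _ (by simp)]; exact bpB)
      (by show Y2.vi (ν (.pv (.pv .F))) = []; rw [c1vi _ (by simp)]; exact bpF) (by show Y2.vi (ν (.pv (.pv .G))) = []; rw [c1vi _ (by simp)]; exact bpG)
      (by show Y2.vi (ν (.pv (.pv .H))) = []; rw [c1vi _ (by simp)]; exact bpH) (by show Y2.vi (ν (.pv (.pv .C))) = []; rw [c1vi _ (by simp)]; exact bpC)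
      c1acc (by show Y2.vo (ω (.po .accN)) = []; rw [c1vo _ (by simp)]; exact baccN) (by show Y2.vo (ω (.po .accT)) = []; rw [c1vo _ (by simp)]; exact baccT)
  have text2 := ptreeP_extOK (𝓔 := 𝓔) M (ApS.ptE.trans ρ) (ApV.pvE.trans ν) (ApO.poE.trans ω) (vals := pts) Y2
      (by show 1 < Y2.sc (ρ (.pt (.pm .n))); rw [c1r _ (by simp) (by simp) (by simp) (by simp) (by simp), bptn]; exact hN)
      (by show Odd (Y2.sc (ρ (.pt (.pm .n)))); rw [c1r _ (by simp) (by simp) (by simp) (by simp) (by simp), bptn]; exact hodd)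
      c1vals (by show Y2.sc (ρ (.pt .nv)) = pts.length; rw [c1nv, hpl]) (by rw [hpl]; exact hpow)
      (by show ∀ v ∈ pts, v < Y2.sc (ρ (.pt (.pm .n))); rw [c1r _ (by simp) (by simp) (by simp) (by simp) (by simp), bptn]; exact hpN)
      (by show Y2.vi (ν (.pv .lvl)) = []; rw [c1vi _ (by simp)]; exact blvl) (by show Y2.vi (ν (.pv .tree)) = []; rw [c1vi _ (by simp)]; exact btree)
      (by show Y2.vi (ν (.pv (.pv .A))) = []; rw [c1vi _ (by simp)]; exact bpA) (by show Y2.vi (ν (.pv (.pv .B))) = []; rw [c1vi _ (by simp)]; exact bpB)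
      (by show Y2.vi (ν (.pv (.pv .F))) = []; rw [c1vi _ (by simp)]; exact bpF) (by show Y2.vi (ν (.pv (.pv .G))) = []; rw [c1vi _ (by simp)]; exact bpG)
      (by show Y2.vi (ν (.pv (.pv .H))) = []; rw [c1vi _ (by simp)]; exact bpH) (by show Y2.vi (ν (.pv (.pv .C))) = []; rw [c1vi _ (by simp)]; exact bpC)
      c1acc (by show Y2.vo (ω (.po .accN)) = []; rw [c1vo _ (by simp)]; exact baccN) (by show Y2.vo (ω (.po .accT)) = []; rw [c1vo _ (by simp)]; exact baccT)
  have hKK2 : K2 = K := by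
    rw [hpl] at hK2a hK2b
    have h1 := (Nat.pow_le_pow_iff_right (show 1 < 2 by norm_num)).1 hK2a
    have h2 : 2 ^ K2 < 2 ^ (K + 1) := by rw [pow_succ]; omega
    have h3 := (Nat.pow_lt_pow_iff_right (show 1 < 2 by norm_num)).1 h2
    omega
  simp only [hKK2] at hK2a hK2b ttree2 tK2 tP2 tpk2 tst2
  clear hKK2 K2
  set Z2 := (ptreeP M (ApS.ptE.trans ρ) (ApV.pvE.trans ν) (ApO.poE.trans ω) : NCom S V O E).eval 𝓔 Y2 with hZ2
  simp only [Function.Embedding.trans_apply, ApS.ptE_apply, ApV.pvE_apply, ApO.poE_apply] at ttree2 tK2 tP2 tnv2 tn2 tlvl2 tvals2 tA2 tB2 tF2 tG2 tH2 tC2 tacc2 taccN2 taccT2 tw2 tvo2 tr2 tpk2 tst2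
  rw [hpl, Nat.sub_self, List.replicate_zero, List.append_nil, c1r _ (by simp) (by simp) (by simp) (by simp) (by simp), bptn] at ttree2
  rw [c1r _ (by simp) (by simp) (by simp) (by simp) (by simp), bptn] at tpk2 tn2
  rw [c1st] at tst2
  clear_value Z2

  -- stage 2b: the tree to the remainder tree's queue, its shape registers
  have htl2 : (treeAcc N pts K (K + 1)).length = (K + 3) * 2 ^ K - 1 := length_treeAcc_full pts K
  have httake2 : (treeAcc N pts K (K + 1)).take ((K + 3) * 2 ^ K - 1) = treeAcc N pts K (K + 1) := List.take_of_length_le (by rw [htl2])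
  have htdrop2 : (treeAcc N pts K (K + 1)).drop ((K + 3) * 2 ^ K - 1) = [] := List.drop_of_length_le (by rw [htl2])
  have zv2 : ∀ w : ApV, (∀ i, w ≠ .pv i) → Z2.vi (ν w) = Y2.vi (ν w) := fun w hw => tw2 _ (fun i => by simpa using hw i)
  have zo2 : ∀ p : ApO, (∀ i, p ≠ .po i) → Z2.vo (ω p) = Y2.vo (ω p) := fun p hp => tvo2 _ (fun i => by simpa using hp i)
  have zs2 : ∀ r : ApS, (∀ i, r ≠ .pt i) → Z2.sc (ρ r) = Y2.sc (ρ r) := fun r hr => tr2 _ (fun i => by simpa using hr i)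
  have z2d : Z2.sc (ρ .d) = 2 ^ K := by rw [zs2 .d (by simp), c1r .d (by simp) (by simp) (by simp) (by simp) (by simp), bd]
  have z2one : Z2.sc (ρ .one) = 1 := by rw [zs2 .one (by simp), c1r .one (by simp) (by simp) (by simp) (by simp) (by simp), bone]
  have z2K : Z2.sc (ρ .K) = K := by rw [zs2 .K (by simp), c1r .K (by simp) (by simp) (by simp) (by simp) (by simp), bK']
  have z2n : Z2.sc (ρ .n) = N := by rw [zs2 .n (by simp), c1r .n (by simp) (by simp) (by simp) (by simp) (by simp), bn']
  have z2s : Z2.sc (ρ .s) = s := by rw [zs2 .s (by simp), c1r .s (by simp) (by simp) (by simp) (by simp) (by simp), bs']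
  have z2M : Z2.sc (ρ .M) = Mv := by rw [zs2 .M (by simp), c1r .M (by simp) (by simp) (by simp) (by simp) (by simp), bM']
  have z2rmn : Z2.sc (ρ (.rm (.dv (.iv (.pm .n))))) = N := by rw [zs2 _ (by simp), c1r _ (by simp) (by simp) (by simp) (by simp) (by simp), brmn]
  have z2rs : ∀ j : RemS, j ≠ .dv (.iv (.pm .n)) → Z2.sc (ρ (.rm j)) = σ.sc (ρ (.rm j)) := fun j hj => by
    rw [zs2 _ (by simp), c1r _ (by simp) (by simp) (by simp) (by simp) (by simp)]; exact b_rs j hj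
  have z2gs : ∀ j : GcdR, Z2.sc (ρ (.gc j)) = σ.sc (ρ (.gc j)) := fun j => by rw [zs2 _ (by simp), c1r _ (by simp) (by simp) (by simp) (by simp) (by simp)]; exact b_gs j
  have z2GIN : Z2.vi (ν (.rv .GIN)) = GIN := by rw [zv2 _ (by simp), c1vi _ (by simp)]; exact bGIN
  have z2rv : ∀ j : RemV, j ≠ .GIN → Z2.vi (ν (.rv j)) = σ.vi (ν (.rv j)) := fun j hj => by rw [zv2 _ (by simp), c1vi _ (by simp)]; exact b_rv j hj
  have z2ro : ∀ j : RemO, Z2.vo (ω (.ro j)) = σ.vo (ω (.ro j)) := fun j => by rw [zo2 _ (by simp), c1vo _ (by simp)]; exact b_ro j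
  have z2o : ∀ r, (∀ i, r ≠ ρ i) → Z2.sc r = σ.sc r := fun r hr => (tr2 r (fun i => hr _)).trans (c1o r hr)
  have z2w : ∀ w, (∀ i, w ≠ ν i) → Z2.vi w = σ.vi w := fun w hw => (tw2 w (fun i => hw _)).trans ((c1vi w (hw _)).trans (b_w w hw))
  have z2p : ∀ p, (∀ i, p ≠ ω i) → Z2.vo p = σ.vo p := fun p hp => (tvo2 p (fun i => hp _)).trans ((c1vo p (hp _)).trans (b_p p hp))
  set X2 := ((setc (ρ .tmp) 3 ;ₙ add (ρ .L) (ρ .K) (ρ .tmp) ;ₙ mul (ρ .L) (ρ .L) (ρ .d) ;ₙ sub (ρ .L) (ρ .L) (ρ .one) ;ₙ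
    moveN (ν (.pv .tree)) (ω (.po .acc)) (ρ (.pt (.pm .x))) (ρ .L) ;ₙ pour (ω (.po .acc)) (ν (.rv .TREE)) ;ₙ
    mov (ρ (.rm .K)) (ρ .K) ;ₙ mov (ρ (.rm .P)) (ρ .d) ;ₙ setc (ρ (.rm .top)) 1 : NCom S V O E)).eval 𝓔 Z2 with hX2
  have hX2s : X2 = ((apStage2 M ρ ν ω : NCom S V O E)).eval 𝓔 X1 := by
    rw [hX2, hZ2, hY2]; simp only [apStage2, eval_seq]
  have hTREE1 : Z2.vi (ν (.rv .TREE)) = [] := (z2rv .TREE (by simp)).trans hTREE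
  have nX2 := hX2
  simp only [eval_seq, eval, moveN_eq' 𝓔, ttree2, tacc2, z2d, z2one, z2K, htl2, httake2, htdrop2, hTREE1, NState.sc_bump, NState.sc_setSc, NState.sc_setVi, NState.sc_setVo, NState.vi_bump,
      NState.vi_setSc, NState.vi_setVi, NState.vi_setVo, NState.vo_bump, NState.vo_setSc, NState.vo_setVi, NState.vo_setVo,
      NState.steps_bump, NState.steps_setSc, NState.steps_setVi, NState.steps_setVo, NState.peak_bump, NState.peak_setSc, NState.peak_setVi,
      NState.peak_setVo, Function.update_apply, EmbeddingLike.apply_eq_iff_eq, reduceCtorEq, ApS.pt.injEq, ApS.rm.injEq, ApS.gc.injEq,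
      ApV.pv.injEq, ApV.rv.injEq, ApO.po.injEq, ApO.ro.injEq, PTreeS.pm.injEq, PTreeV.pv.injEq, RemS.dv.injEq, RemV.rv.injEq, RemO.ro.injEq,
      DivS.iv.injEq, DivV.vv.injEq, DivO.vo.injEq, InvS.pm.injEq, InvV.pv.injEq, InvS.ln.injEq,
      ite_true, ite_false, not_false_eq_true, implies_true, Nat.max_zero, Nat.zero_max, Nat.le_add_right,
      List.take_length, List.drop_length, List.nil_append, List.append_nil, le_refl, List.take_append_drop, List.length_nil, List.length_append,
      List.length_take, length_apRoots, length_apPoints] at nX2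
  obtain ⟨eTREE, eGIN, eREM, etree, eacc, evals, elvl, epA, epB, epF, epG, epH, epC, eaccN, eaccT, eptn, ed, eone, en', es', eM', eK', ermn, ermK, ermP, ertop⟩ :
      X2.vi (ν (.rv .TREE)) = treeAcc N pts K (K + 1) ∧ X2.vi (ν (.rv .GIN)) = GIN ∧ X2.vi (ν (.rv .REM)) = [] ∧ X2.vi (ν (.pv .tree)) = [] ∧
      X2.vo (ω (.po .acc)) = [] ∧ X2.vi (ν (.pv .vals)) = [] ∧ X2.vi (ν (.pv .lvl)) = [] ∧
      X2.vi (ν (.pv (.pv .A))) = [] ∧ X2.vi (ν (.pv (.pv .B))) = [] ∧ X2.vi (ν (.pv (.pv .F))) = [] ∧ X2.vi (ν (.pv (.pv .G))) = [] ∧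
      X2.vi (ν (.pv (.pv .H))) = [] ∧ X2.vi (ν (.pv (.pv .C))) = [] ∧ X2.vo (ω (.po .accN)) = [] ∧ X2.vo (ω (.po .accT)) = [] ∧
      X2.sc (ρ (.pt (.pm .n))) = N ∧ X2.sc (ρ .d) = 2 ^ K ∧ X2.sc (ρ .one) = 1 ∧ X2.sc (ρ .n) = N ∧ X2.sc (ρ .s) = s ∧ X2.sc (ρ .M) = Mv ∧ X2.sc (ρ .K) = K ∧
      X2.sc (ρ (.rm (.dv (.iv (.pm .n))))) = N ∧ X2.sc (ρ (.rm .K)) = K ∧ X2.sc (ρ (.rm .P)) = 2 ^ K ∧ X2.sc (ρ (.rm .top)) = 1 := by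
    rw [nX2]; simp only [tvals2, tlvl2, tA2, tB2, tF2, tG2, tH2, tC2, taccN2, taccT2, tn2, z2d, z2one, z2n, z2s, z2M, z2K, z2rmn, z2GIN, z2rv .REM (by simp), hREM,
      NState.sc_bump, NState.sc_setSc, NState.sc_setVi, NState.sc_setVo, NState.vi_bump,
      NState.vi_setSc, NState.vi_setVi, NState.vi_setVo, NState.vo_bump, NState.vo_setSc, NState.vo_setVi, NState.vo_setVo,
      NState.steps_bump, NState.steps_setSc, NState.steps_setVi, NState.steps_setVo, NState.peak_bump, NState.peak_setSc, NState.peak_setVi,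
      NState.peak_setVo, Function.update_apply, EmbeddingLike.apply_eq_iff_eq, reduceCtorEq, ApS.pt.injEq, ApS.rm.injEq, ApS.gc.injEq,
      ApV.pv.injEq, ApV.rv.injEq, ApO.po.injEq, ApO.ro.injEq, PTreeS.pm.injEq, PTreeV.pv.injEq, RemS.dv.injEq, RemV.rv.injEq, RemO.ro.injEq,
      DivS.iv.injEq, DivV.vv.injEq, DivO.vo.injEq, InvS.pm.injEq, InvV.pv.injEq, InvS.ln.injEq,
      ite_true, ite_false, not_false_eq_true, implies_true, Nat.max_zero, Nat.zero_max, Nat.le_add_right,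
      List.take_length, List.drop_length, List.nil_append, List.append_nil, le_refl, List.take_append_drop, List.length_nil, List.length_append,
      List.length_take, length_apRoots, length_apPoints, and_self, and_true, true_and]
  have e_rs : ∀ j : RemS, j ≠ .dv (.iv (.pm .n)) → j ≠ .K → j ≠ .P → j ≠ .top → X2.sc (ρ (.rm j)) = σ.sc (ρ (.rm j)) := fun j h1 h2 h3 h4 => by
    rw [← z2rs j h1, nX2]; simp only [h2, h3, h4, NState.sc_bump, NState.sc_setSc, NState.sc_setVi, NState.sc_setVo, NState.vi_bump,
      NState.vi_setSc, NState.vi_setVi, NState.vi_setVo, NState.vo_bump, NState.vo_setSc, NState.vo_setVi, NState.vo_setVo,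
      NState.steps_bump, NState.steps_setSc, NState.steps_setVi, NState.steps_setVo, NState.peak_bump, NState.peak_setSc, NState.peak_setVi,
      NState.peak_setVo, Function.update_apply, EmbeddingLike.apply_eq_iff_eq, reduceCtorEq, ApS.pt.injEq, ApS.rm.injEq, ApS.gc.injEq,
      ApV.pv.injEq, ApV.rv.injEq, ApO.po.injEq, ApO.ro.injEq, PTreeS.pm.injEq, PTreeV.pv.injEq, RemS.dv.injEq, RemV.rv.injEq, RemO.ro.injEq,
      DivS.iv.injEq, DivV.vv.injEq, DivO.vo.injEq, InvS.pm.injEq, InvV.pv.injEq, InvS.ln.injEq,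
      ite_true, ite_false, not_false_eq_true, implies_true, Nat.max_zero, Nat.zero_max, Nat.le_add_right,
      List.take_length, List.drop_length, List.nil_append, List.append_nil, le_refl, List.take_append_drop, List.length_nil, List.length_append,
      List.length_take, length_apRoots, length_apPoints]
  have e_gs : ∀ j : GcdR, X2.sc (ρ (.gc j)) = σ.sc (ρ (.gc j)) := fun j => by rw [← z2gs j, nX2]; simp only [NState.sc_bump, NState.sc_setSc, NState.sc_setVi, NState.sc_setVo, NState.vi_bump,
      NState.vi_setSc, NState.vi_setVi, NState.vi_setVo, NState.vo_bump, NState.vo_setSc, NState.vo_setVi, NState.vo_setVo,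
      NState.steps_bump, NState.steps_setSc, NState.steps_setVi, NState.steps_setVo, NState.peak_bump, NState.peak_setSc, NState.peak_setVi,
      NState.peak_setVo, Function.update_apply, EmbeddingLike.apply_eq_iff_eq, reduceCtorEq, ApS.pt.injEq, ApS.rm.injEq, ApS.gc.injEq,
      ApV.pv.injEq, ApV.rv.injEq, ApO.po.injEq, ApO.ro.injEq, PTreeS.pm.injEq, PTreeV.pv.injEq, RemS.dv.injEq, RemV.rv.injEq, RemO.ro.injEq,
      DivS.iv.injEq, DivV.vv.injEq, DivO.vo.injEq, InvS.pm.injEq, InvV.pv.injEq, InvS.ln.injEq,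
      ite_true, ite_false, not_false_eq_true, implies_true, Nat.max_zero, Nat.zero_max, Nat.le_add_right,
      List.take_length, List.drop_length, List.nil_append, List.append_nil, le_refl, List.take_append_drop, List.length_nil, List.length_append,
      List.length_take, length_apRoots, length_apPoints]
  have e_rv : ∀ j : RemV, j ≠ .GIN → j ≠ .TREE → X2.vi (ν (.rv j)) = σ.vi (ν (.rv j)) := fun j h1 h2 => by rw [← z2rv j h1, nX2]; simp only [h2, NState.sc_bump, NState.sc_setSc, NState.sc_setVi, NState.sc_setVo, NState.vi_bump,
      NState.vi_setSc, NState.vi_setVi, NState.vi_setVo, NState.vo_bump, NState.vo_setSc, NState.vo_setVi, NState.vo_setVo,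
      NState.steps_bump, NState.steps_setSc, NState.steps_setVi, NState.steps_setVo, NState.peak_bump, NState.peak_setSc, NState.peak_setVi,
      NState.peak_setVo, Function.update_apply, EmbeddingLike.apply_eq_iff_eq, reduceCtorEq, ApS.pt.injEq, ApS.rm.injEq, ApS.gc.injEq,
      ApV.pv.injEq, ApV.rv.injEq, ApO.po.injEq, ApO.ro.injEq, PTreeS.pm.injEq, PTreeV.pv.injEq, RemS.dv.injEq, RemV.rv.injEq, RemO.ro.injEq,
      DivS.iv.injEq, DivV.vv.injEq, DivO.vo.injEq, InvS.pm.injEq, InvV.pv.injEq, InvS.ln.injEq,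
      ite_true, ite_false, not_false_eq_true, implies_true, Nat.max_zero, Nat.zero_max, Nat.le_add_right,
      List.take_length, List.drop_length, List.nil_append, List.append_nil, le_refl, List.take_append_drop, List.length_nil, List.length_append,
      List.length_take, length_apRoots, length_apPoints]
  have e_ro : ∀ j : RemO, X2.vo (ω (.ro j)) = σ.vo (ω (.ro j)) := fun j => by rw [← z2ro j, nX2]; simp only [NState.sc_bump, NState.sc_setSc, NState.sc_setVi, NState.sc_setVo, NState.vi_bump,
      NState.vi_setSc, NState.vi_setVi, NState.vi_setVo, NState.vo_bump, NState.vo_setSc, NState.vo_setVi, NState.vo_setVo,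
      NState.steps_bump, NState.steps_setSc, NState.steps_setVi, NState.steps_setVo, NState.peak_bump, NState.peak_setSc, NState.peak_setVi,
      NState.peak_setVo, Function.update_apply, EmbeddingLike.apply_eq_iff_eq, reduceCtorEq, ApS.pt.injEq, ApS.rm.injEq, ApS.gc.injEq,
      ApV.pv.injEq, ApV.rv.injEq, ApO.po.injEq, ApO.ro.injEq, PTreeS.pm.injEq, PTreeV.pv.injEq, RemS.dv.injEq, RemV.rv.injEq, RemO.ro.injEq,
      DivS.iv.injEq, DivV.vv.injEq, DivO.vo.injEq, InvS.pm.injEq, InvV.pv.injEq, InvS.ln.injEq,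
      ite_true, ite_false, not_false_eq_true, implies_true, Nat.max_zero, Nat.zero_max, Nat.le_add_right,
      List.take_length, List.drop_length, List.nil_append, List.append_nil, le_refl, List.take_append_drop, List.length_nil, List.length_append,
      List.length_take, length_apRoots, length_apPoints]
  have e_o : ∀ r, (∀ i, r ≠ ρ i) → X2.sc r = σ.sc r := fun r hr => by rw [← z2o r hr, nX2]; simp only [hr, NState.sc_bump, NState.sc_setSc, NState.sc_setVi, NState.sc_setVo, NState.vi_bump,
      NState.vi_setSc, NState.vi_setVi, NState.vi_setVo, NState.vo_bump, NState.vo_setSc, NState.vo_setVi, NState.vo_setVo,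
      NState.steps_bump, NState.steps_setSc, NState.steps_setVi, NState.steps_setVo, NState.peak_bump, NState.peak_setSc, NState.peak_setVi,
      NState.peak_setVo, Function.update_apply, EmbeddingLike.apply_eq_iff_eq, reduceCtorEq, ApS.pt.injEq, ApS.rm.injEq, ApS.gc.injEq,
      ApV.pv.injEq, ApV.rv.injEq, ApO.po.injEq, ApO.ro.injEq, PTreeS.pm.injEq, PTreeV.pv.injEq, RemS.dv.injEq, RemV.rv.injEq, RemO.ro.injEq,
      DivS.iv.injEq, DivV.vv.injEq, DivO.vo.injEq, InvS.pm.injEq, InvV.pv.injEq, InvS.ln.injEq,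
      ite_true, ite_false, not_false_eq_true, implies_true, Nat.max_zero, Nat.zero_max, Nat.le_add_right,
      List.take_length, List.drop_length, List.nil_append, List.append_nil, le_refl, List.take_append_drop, List.length_nil, List.length_append,
      List.length_take, length_apRoots, length_apPoints]
  have e_w : ∀ w, (∀ i, w ≠ ν i) → X2.vi w = σ.vi w := fun w hw => by rw [← z2w w hw, nX2]; simp only [hw, NState.sc_bump, NState.sc_setSc, NState.sc_setVi, NState.sc_setVo, NState.vi_bump,
      NState.vi_setSc, NState.vi_setVi, NState.vi_setVo, NState.vo_bump, NState.vo_setSc, NState.vo_setVi, NState.vo_setVo,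
      NState.steps_bump, NState.steps_setSc, NState.steps_setVi, NState.steps_setVo, NState.peak_bump, NState.peak_setSc, NState.peak_setVi,
      NState.peak_setVo, Function.update_apply, EmbeddingLike.apply_eq_iff_eq, reduceCtorEq, ApS.pt.injEq, ApS.rm.injEq, ApS.gc.injEq,
      ApV.pv.injEq, ApV.rv.injEq, ApO.po.injEq, ApO.ro.injEq, PTreeS.pm.injEq, PTreeV.pv.injEq, RemS.dv.injEq, RemV.rv.injEq, RemO.ro.injEq,
      DivS.iv.injEq, DivV.vv.injEq, DivO.vo.injEq, InvS.pm.injEq, InvV.pv.injEq, InvS.ln.injEq,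
      ite_true, ite_false, not_false_eq_true, implies_true, Nat.max_zero, Nat.zero_max, Nat.le_add_right,
      List.take_length, List.drop_length, List.nil_append, List.append_nil, le_refl, List.take_append_drop, List.length_nil, List.length_append,
      List.length_take, length_apRoots, length_apPoints]
  have e_p : ∀ p, (∀ i, p ≠ ω i) → X2.vo p = σ.vo p := fun p hp => by rw [← z2p p hp, nX2]; simp only [hp, NState.sc_bump, NState.sc_setSc, NState.sc_setVi, NState.sc_setVo, NState.vi_bump,
      NState.vi_setSc, NState.vi_setVi, NState.vi_setVo, NState.vo_bump, NState.vo_setSc, NState.vo_setVi, NState.vo_setVo,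
      NState.steps_bump, NState.steps_setSc, NState.steps_setVi, NState.steps_setVo, NState.peak_bump, NState.peak_setSc, NState.peak_setVi,
      NState.peak_setVo, Function.update_apply, EmbeddingLike.apply_eq_iff_eq, reduceCtorEq, ApS.pt.injEq, ApS.rm.injEq, ApS.gc.injEq,
      ApV.pv.injEq, ApV.rv.injEq, ApO.po.injEq, ApO.ro.injEq, PTreeS.pm.injEq, PTreeV.pv.injEq, RemS.dv.injEq, RemV.rv.injEq, RemO.ro.injEq,
      DivS.iv.injEq, DivV.vv.injEq, DivO.vo.injEq, InvS.pm.injEq, InvV.pv.injEq, InvS.ln.injEq,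
      ite_true, ite_false, not_false_eq_true, implies_true, Nat.max_zero, Nat.zero_max, Nat.le_add_right,
      List.take_length, List.drop_length, List.nil_append, List.append_nil, le_refl, List.take_append_drop, List.length_nil, List.length_append,
      List.length_take, length_apRoots, length_apPoints]
  have epk : X2.peak = max (max (max (max Z2.peak 3) (K + 3)) ((K + 3) * 2 ^ K)) 1 := by rw [nX2]; simp only [NState.sc_bump, NState.sc_setSc, NState.sc_setVi, NState.sc_setVo, NState.vi_bump,
      NState.vi_setSc, NState.vi_setVi, NState.vi_setVo, NState.vo_bump, NState.vo_setSc, NState.vo_setVi, NState.vo_setVo,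
      NState.steps_bump, NState.steps_setSc, NState.steps_setVi, NState.steps_setVo, NState.peak_bump, NState.peak_setSc, NState.peak_setVi,
      NState.peak_setVo, Function.update_apply, EmbeddingLike.apply_eq_iff_eq, reduceCtorEq, ApS.pt.injEq, ApS.rm.injEq, ApS.gc.injEq,
      ApV.pv.injEq, ApV.rv.injEq, ApO.po.injEq, ApO.ro.injEq, PTreeS.pm.injEq, PTreeV.pv.injEq, RemS.dv.injEq, RemV.rv.injEq, RemO.ro.injEq,
      DivS.iv.injEq, DivV.vv.injEq, DivO.vo.injEq, InvS.pm.injEq, InvV.pv.injEq, InvS.ln.injEq,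
      ite_true, ite_false, not_false_eq_true, implies_true, Nat.max_zero, Nat.zero_max, Nat.le_add_right,
      List.take_length, List.drop_length, List.nil_append, List.append_nil, le_refl, List.take_append_drop, List.length_nil, List.length_append,
      List.length_take, length_apRoots, length_apPoints]
  have est : X2.steps = Z2.steps + 4 * ((K + 3) * 2 ^ K - 1) + 9 := by
    rw [nX2]; simp only [NState.sc_bump, NState.sc_setSc, NState.sc_setVi, NState.sc_setVo, NState.vi_bump,
      NState.vi_setSc, NState.vi_setVi, NState.vi_setVo, NState.vo_bump, NState.vo_setSc, NState.vo_setVi, NState.vo_setVo,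
      NState.steps_bump, NState.steps_setSc, NState.steps_setVi, NState.steps_setVo, NState.peak_bump, NState.peak_setSc, NState.peak_setVi,
      NState.peak_setVo, Function.update_apply, EmbeddingLike.apply_eq_iff_eq, reduceCtorEq, ApS.pt.injEq, ApS.rm.injEq, ApS.gc.injEq,
      ApV.pv.injEq, ApV.rv.injEq, ApO.po.injEq, ApO.ro.injEq, PTreeS.pm.injEq, PTreeV.pv.injEq, RemS.dv.injEq, RemV.rv.injEq, RemO.ro.injEq,
      DivS.iv.injEq, DivV.vv.injEq, DivO.vo.injEq, InvS.pm.injEq, InvV.pv.injEq, InvS.ln.injEq,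
      ite_true, ite_false, not_false_eq_true, implies_true, Nat.max_zero, Nat.zero_max, Nat.le_add_right,
      List.take_length, List.drop_length, List.nil_append, List.append_nil, le_refl, List.take_append_drop, List.length_nil, List.length_append,
      List.length_take, length_apRoots, length_apPoints]
    have h13 : 1 * 1 ≤ (K + 3) * 2 ^ K := Nat.mul_le_mul (by omega) hpow
    clear * - h13; omega
  clear_value X2
  clear nX2 hX2
  -- the remainder tree
  have hGIN_N : ∀ x ∈ GIN, x < N := fun x hx => lt_of_mem_treeBlock hN hx
  have hGtop : GIN.getD (2 ^ K) 0 = 1 := by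
    have hl := getLast_treeBlock (N := N) hN (vals := roots) (j := K) (i := 0) (by rw [hrl]; omega)
    rw [List.getLast?_eq_getElem?, hGl, Nat.add_sub_cancel] at hl
    rw [List.getD_eq_getElem?_getD, hl]; rfl
  have hRI : RemInv (ApS.rmE.trans ρ) (ApV.rvE.trans ν) (ApO.roE.trans ω) N X2 :=
    ⟨ermn, (e_rv _ (by simp) (by simp)).trans hrT, (e_rv _ (by simp) (by simp)).trans hrT2, (e_rv _ (by simp) (by simp)).trans hrQ,
     (e_rv _ (by simp) (by simp)).trans hrRB, (e_rv _ (by simp) (by simp)).trans hrG, (e_rv _ (by simp) (by simp)).trans hrpA,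
     (e_rv _ (by simp) (by simp)).trans hrpB, (e_rv _ (by simp) (by simp)).trans hrpF, (e_rv _ (by simp) (by simp)).trans hrpG,
     (e_rv _ (by simp) (by simp)).trans hrpH, (e_rv _ (by simp) (by simp)).trans hrpC, (e_ro _).trans hracc, (e_ro _).trans hracc2,
     (e_ro _).trans hraccL, (e_ro _).trans hraccP, (e_rv _ (by simp) (by simp)).trans hrDA, (e_rv _ (by simp) (by simp)).trans hrDB⟩
  obtain ⟨rI, rREM, rTREE, rGIN, raccR, rK, rw', ro', rs', rpk, rst, rext⟩ :=
    remtreeP_spec (𝓔 := 𝓔) M (ApS.rmE.trans ρ) (ApV.rvE.trans ν) (ApO.roE.trans ω) hN hodd GIN pts K X2 hRI ermK ermP (by show X2.sc (ρ (.rm .top)) = _; rw [ertop, hGtop])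
      (by show X2.sc (ρ (.rm .top)) ≤ 1; rw [ertop]) eGIN hGl hGIN_N eTREE hpl eREM ((e_ro _).trans hraccR)
  set Y3 := (remtreeP M (ApS.rmE.trans ρ) (ApV.rvE.trans ν) (ApO.roE.trans ω) : NCom S V O E).eval 𝓔 X2 with hY3
  simp only [Function.Embedding.trans_apply, ApS.rmE_apply, ApV.rvE_apply, ApO.roE_apply] at rREM rTREE rGIN raccR rK rw' ro' rs' rpk rst
  clear_value Y3

  -- facts at `Y3`
  obtain ⟨ri1, ri2, ri3, ri4, ri5, ri6, ri7, ri8, ri9, ri10, ri11, ri12, ri13, ri14, ri15, ri16, ri17, ri18⟩ := rI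
  simp only [Function.Embedding.trans_apply, ApS.rmE_apply, ApV.rvE_apply, ApO.roE_apply] at ri1 ri2 ri3 ri4 ri5 ri6 ri7 ri8 ri9 ri10 ri11 ri12 ri13 ri14 ri15 ri16 ri17 ri18
  have y3r : ∀ r : ApS, (∀ i, r ≠ .rm i) → Y3.sc (ρ r) = X2.sc (ρ r) := fun r hr => rs' _ (fun i => by simpa using hr i)
  have y3pv : ∀ j : PTreeV, Y3.vi (ν (.pv j)) = X2.vi (ν (.pv j)) := fun j => rw' _ (fun i => by simp)
  have y3po : ∀ j : PTreeO, Y3.vo (ω (.po j)) = X2.vo (ω (.po j)) := fun j => ro' _ (fun i => by simp)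
  have y3n : Y3.sc (ρ .n) = N := (y3r .n (by simp)).trans en'
  have y3s : Y3.sc (ρ .s) = s := (y3r .s (by simp)).trans es'
  have y3M : Y3.sc (ρ .M) = Mv := (y3r .M (by simp)).trans eM'
  have y3K : Y3.sc (ρ .K) = K := (y3r .K (by simp)).trans eK'
  have y3d : Y3.sc (ρ .d) = 2 ^ K := (y3r .d (by simp)).trans ed
  have y3one : Y3.sc (ρ .one) = 1 := (y3r .one (by simp)).trans eone
  have y3ptn : Y3.sc (ρ (.pt (.pm .n))) = N := (y3r _ (by simp)).trans eptn
  have y3o : ∀ r, (∀ i, r ≠ ρ i) → Y3.sc r = σ.sc r := fun r hr => (rs' r (fun i => hr _)).trans (e_o r hr)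
  have y3w : ∀ w, (∀ i, w ≠ ν i) → Y3.vi w = σ.vi w := fun w hw => (rw' w (fun i => hw _)).trans (e_w w hw)
  have y3p : ∀ p, (∀ i, p ≠ ω i) → Y3.vo p = σ.vo p := fun p hp => (ro' p (fun i => hp _)).trans (e_p p hp)
  -- extension calls of the two product trees
  have hY1e := hY1; simp only [eval_seq] at hY1e
  have hY2e := hY2; simp only [eval_seq] at hY2e
  have ext1 : (apStage1 M ρ ν ω : NCom S V O E).extOK 𝓔 X0 := by
    simp only [apStage1, extOK_seq]
    rw [← hY1e, ← hZ1]
    exact ⟨trivial, extOK_of_noExt 𝓔 (by simp [apRootsBody, noExt]) _, trivial, trivial, text1, trivial,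
      extOK_of_noExt 𝓔 (moveN_noExt _ _ _ _) _, trivial, trivial⟩
  have ext2 : (apStage2 M ρ ν ω : NCom S V O E).extOK 𝓔 X1 := by
    simp only [apStage2, extOK_seq]
    rw [← hY2e, ← hZ2]
    exact ⟨trivial, extOK_of_noExt 𝓔 (by simp [apPointsBody, noExt]) _, trivial, trivial, text2, trivial, trivial, trivial, trivial,
      extOK_of_noExt 𝓔 (moveN_noExt _ _ _ _) _, trivial, trivial, trivial, trivial⟩
  -- peak bookkeeping up to `Y3`
  have hKB : 2 ^ K ≤ apPeakBound N s Mv K := (Nat.le_mul_of_pos_left (2 ^ K) (Nat.succ_pos _)).trans q4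
  have h1B : 1 ≤ apPeakBound N s Mv K := by clear * -; unfold apPeakBound; omega
  have hNB : N ≤ apPeakBound N s Mv K := by clear * -; unfold apPeakBound; omega
  have P0 : X0.peak ≤ max σ.peak (apPeakBound N s Mv K) := x0pk.trans (max_le (le_max_left _ _) (le_max_of_le_right (max_le h1B hKB)))
  have P1 : Y1.peak ≤ max σ.peak (apPeakBound N s Mv K) := y1pk.trans (max_le (le_max_left _ _) (le_max_of_le_right (max_le hKB q3)))
  have P2 : Z1.peak ≤ max σ.peak (apPeakBound N s Mv K) := tpk.trans (max_le P1 (le_max_of_le_right (max_le hNB q5)))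
  have h46 : 2 ^ K + 1 ≤ apPeakBound N s Mv K := le_trans (by clear * -; omega) q6b
  have P3 : X1.peak ≤ max σ.peak (apPeakBound N s Mv K) := by rw [bpk]; exact max_le P2 (le_max_of_le_right h46)
  have P4' : Y2.peak ≤ max σ.peak (apPeakBound N s Mv K) := c1pk.trans (max_le P3 (le_max_of_le_right q2))
  have P5 : Z2.peak ≤ max σ.peak (apPeakBound N s Mv K) := tpk2.trans (max_le P4' (le_max_of_le_right (max_le hNB q5)))
  have h3B : 3 ≤ apPeakBound N s Mv K := le_trans (Nat.le_add_left 3 K) q6d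
  have P6 : X2.peak ≤ max σ.peak (apPeakBound N s Mv K) := by
    rw [epk]
    exact max_le (max_le (max_le (max_le P5 (le_max_of_le_right h3B)) (le_max_of_le_right q6d)) (le_max_of_le_right q4))
      (le_max_of_le_right (le_trans hpow hKB))
  have P7 : Y3.peak ≤ max σ.peak (apPeakBound N s Mv K) := rpk.trans (max_le P6 (le_max_of_le_right (max_le q6a q6b)))
  -- steps bookkeeping up to `Y3`
  have S7 : Y3.steps + 2 ^ K * (10 * N.size + 8) + 2 ^ K * (10 * N.size + 12) + 2 * 2 ^ K + 14 ≤ σ.steps + apCost M.cost N K := by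
    unfold apCost
    have e1 : 300 * (K + 1) * 2 ^ K = 300 * (K * 2 ^ K) + 300 * 2 ^ K := by ring
    have e2 : (6 * K + 60) * 2 ^ K = 6 * (K * 2 ^ K) + 60 * 2 ^ K := by ring
    have e3 : 2 ^ K * (20 * N.size + 40) = 20 * (2 ^ K * N.size) + 40 * 2 ^ K := by ring
    have e4 : (K + 7) * 2 ^ K = K * 2 ^ K + 7 * 2 ^ K := by ring
    have e5 : 4 * ((K + 3) * 2 ^ K - 1) ≤ 4 * (K * 2 ^ K) + 12 * 2 ^ K := by
      clear * -
      have : (K + 3) * 2 ^ K = K * 2 ^ K + 3 * 2 ^ K := by ring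
      omega
    have e6 : 2 ^ K * (10 * N.size + 8) = 10 * (2 ^ K * N.size) + 8 * 2 ^ K := by ring
    have e7 : 2 ^ K * (10 * N.size + 12) = 10 * (2 ^ K * N.size) + 12 * 2 ^ K := by ring
    have hKle : K ≤ K * 2 ^ K := Nat.le_mul_of_pos_right _ hpow
    have hKP : K ≤ 2 ^ K := Nat.lt_two_pow_self.le
    rw [e1, e2, e3, e6, e7]
    rw [e4] at bst
    rw [e1] at tst tst2
    have c2 := y1st; have c3 := tst; have c4 := bst; have c5 := c1st; have c6 := tst2; have c7 := est; have c8 := rst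
    clear * - c2 c3 c4 c5 c6 c7 c8 e5 hKle hKP hpow
    generalize K * 2 ^ K = Q at *
    generalize 2 ^ K * N.size = R at *
    generalize 2 ^ K = P at *
    generalize treeCostD M.cost K K = TC at *
    generalize remCostD M.cost K K = RC at *
    omega
  -- export (the state is packaged existentially; the extension calls at the explicit prefix states)
  have AINV : ApInv ρ ν ω N Y3 :=
    ⟨y3one, y3ptn, ri1, (y3pv _).trans elvl, (y3pv _).trans epA, (y3pv _).trans epB, (y3pv _).trans epF, (y3pv _).trans epG,
      (y3pv _).trans epH, (y3pv _).trans epC, (y3po _).trans eacc, (y3po _).trans eaccN, (y3po _).trans eaccT,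
      ri2, ri3, ri4, ri5, ri6, ri7, ri8, ri9, ri10, ri11, ri12, ri13, ri14, ri15, ri16, raccR, ri17, ri18⟩
  have yvals : Y3.vi (ν (.pv .vals)) = [] := (y3pv _).trans evals
  have ytree : Y3.vi (ν (.pv .tree)) = [] := (y3pv _).trans etree
  have xinit : (apInit ρ : NCom S V O E).extOK 𝓔 σ := extOK_of_noExt 𝓔 (by simp [apInit, noExt]) σ
  have hY3full : Y3 = ((remtreeP M (ApS.rmE.trans ρ) (ApV.rvE.trans ν) (ApO.roE.trans ω) : NCom S V O E).eval 𝓔 ((apStage2 M ρ ν ω : NCom S V O E).eval 𝓔 ((apStage1 M ρ ν ω : NCom S V O E).eval 𝓔 ((apInit ρ : NCom S V O E).eval 𝓔 σ)))) := by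
    rw [hY3, hX2s, hX1s, hX0]
  rw [hX2s, hX1s, hX0] at rext
  rw [hX1s, hX0] at ext2
  rw [hX0] at ext1
  exact ⟨Y3, hY3full, AINV, rREM, rTREE, rGIN, yvals, ytree, y3n, y3s, y3M, y3K, y3d, y3o, y3w, y3p, P7, S7, xinit, ext1, ext2, rext⟩


set_option maxHeartbeats 20000000 in
set_option linter.unusedSimpArgs false in -- one uniform simp set drives the symbolic execution of every stage
/-- **Specification of the arithmetic-progression scan** `apScanP` (Harvey 2021, Prop. 2.5 for
the progression `s + M k`): with `d = 2^K`, afterwards `found ∈ {0, 1}`; if `found = 1` then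
`kout` is the least `k` in `1 … d²` with `gcd (s + M k, N) > 1`; if `found = 0` there is no
such `k`.  Inputs are kept, all work queues of both register banks are empty again;
`peak ≤ max peak (apPeakBound N s M K)`, `steps ≤ steps + apCost cost N K`. [folklore] -/
theorem apScanP_spec (σ : NState S V O) (N s Mv K : ℕ) (hN : 1 < N) (hodd : Odd N) (hI : ApInv ρ ν ω N σ)
    (hn : σ.sc (ρ .n) = N) (hs : σ.sc (ρ .s) = s) (hM : σ.sc (ρ .M) = Mv) (hK : σ.sc (ρ .K) = K)
    (hvals : σ.vi (ν (.pv .vals)) = []) (htree : σ.vi (ν (.pv .tree)) = []) (hREM : σ.vi (ν (.rv .REM)) = []) (hTREE : σ.vi (ν (.rv .TREE)) = [])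
    (hGIN : σ.vi (ν (.rv .GIN)) = []) :
    let τ := (apScanP M ρ ν ω : NCom S V O E).eval 𝓔 σ
    (τ.sc (ρ .found) = 0 ∨ τ.sc (ρ .found) = 1) ∧
      (τ.sc (ρ .found) = 1 → 1 ≤ τ.sc (ρ .kout) ∧ τ.sc (ρ .kout) ≤ 2 ^ K * 2 ^ K ∧ 1 < Nat.gcd (apCand s Mv (τ.sc (ρ .kout))) N ∧
        ∀ k, 1 ≤ k → k < τ.sc (ρ .kout) → Nat.gcd (apCand s Mv k) N ≤ 1) ∧
      (τ.sc (ρ .found) = 0 → ∀ k, 1 ≤ k → k ≤ 2 ^ K * 2 ^ K → Nat.gcd (apCand s Mv k) N ≤ 1) ∧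
      ApInv ρ ν ω N τ ∧ τ.sc (ρ .n) = N ∧ τ.sc (ρ .s) = s ∧ τ.sc (ρ .M) = Mv ∧ τ.sc (ρ .K) = K ∧
      τ.vi (ν (.pv .vals)) = [] ∧ τ.vi (ν (.pv .tree)) = [] ∧ τ.vi (ν (.rv .REM)) = [] ∧ τ.vi (ν (.rv .TREE)) = [] ∧ τ.vi (ν (.rv .GIN)) = [] ∧
      (∀ w, (∀ i, w ≠ ν i) → τ.vi w = σ.vi w) ∧ (∀ p, (∀ i, p ≠ ω i) → τ.vo p = σ.vo p) ∧ (∀ r, (∀ i, r ≠ ρ i) → τ.sc r = σ.sc r) ∧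
      τ.peak ≤ max σ.peak (apPeakBound N s Mv K) ∧
      τ.steps ≤ σ.steps + apCost M.cost N K ∧
      (apScanP M ρ ν ω : NCom S V O E).extOK 𝓔 σ := by
  intro τ
  have hpow : 1 ≤ 2 ^ K := Nat.one_le_two_pow
  have hN0 : 0 < N := Nat.zero_lt_of_lt hN
  obtain ⟨Y3, hY3, aI, aREM, aTREE, aGIN, avals, atree, y3n, y3s, y3M, y3K, y3d, y3o, y3w, y3p, P7, S7, xInit, x1, x2, xRem⟩ :=
    apScanP_pre M ρ ν ω σ N s Mv K hN hodd hI hn hs hM hK hvals htree hREM hTREE hGIN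
  have hτ0 : τ = (apStage3 ρ ν : NCom S V O E).eval 𝓔 Y3 := by
    show (apScanP M ρ ν ω : NCom S V O E).eval 𝓔 σ = _
    rw [hY3]; simp only [apScanP, eval_seq]
  obtain ⟨y3one, y3ptn, ri1, blvl, bpA, bpB, bpF, bpG, bpH, bpC, bacc, baccN, baccT, ri2, ri3, ri4, ri5, ri6, ri7, ri8, ri9, ri10, ri11, ri12,
    ri13, ri14, ri15, ri16, raccR, ri17, ri18⟩ := aI
  have q1 : ∀ u0, u0 < 2 ^ K → 2 ^ K + u0 * 2 ^ K + Mv * (u0 * 2 ^ K + 2 ^ K) + s ≤ apPeakBound N s Mv K := by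
    intro u0 hu0; clear * - hu0; unfold apPeakBound
    have h1 : u0 * 2 ^ K + 2 ^ K ≤ (2 ^ K + 1) * (2 ^ K + 1) := by nlinarith [Nat.mul_le_mul_right (2 ^ K) (Nat.succ_le_of_lt hu0)]
    have h2 : Mv * (u0 * 2 ^ K + 2 ^ K) ≤ Mv * ((2 ^ K + 1) * (2 ^ K + 1)) := Nat.mul_le_mul_left _ h1
    have h3 : Mv * ((2 ^ K + 1) * (2 ^ K + 1)) + 2 * ((2 ^ K + 1) * (2 ^ K + 1)) = (Mv + 2) * (2 ^ K + 1) * (2 ^ K + 1) := by ring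
    have h4 : 2 ^ K + u0 * 2 ^ K ≤ 2 * ((2 ^ K + 1) * (2 ^ K + 1)) := by nlinarith [h1]
    omega
  have hKD3 : (K + 3) * 2 ^ K ≤ (K + 8) * 2 ^ K := Nat.mul_le_mul_right _ (Nat.add_le_add_left (by decide) K)
  have hszN : N.size ≤ N := Nat.size_le.2 Nat.lt_two_pow_self
  have q4 : (K + 3) * 2 ^ K ≤ apPeakBound N s Mv K := by
    have h := hKD3; clear * - h; unfold apPeakBound; generalize 2 ^ K = P at *; omega
  have q6c : 2 * N.size ≤ apPeakBound N s Mv K := by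
    have h := hszN; clear * - h; unfold apPeakBound; generalize 2 ^ K = P at *; omega
  have hKB : 2 ^ K ≤ apPeakBound N s Mv K := (Nat.le_mul_of_pos_left (2 ^ K) (Nat.succ_pos _)).trans q4
  -- the values scanned
  obtain ⟨ws, hws⟩ : ∃ ws, ws = (List.range (2 ^ K)).map (fun i => ((listPoly N (treeBlock N (apRoots N s Mv (2 ^ K)) K 0)).eval
      ((((apPoints N Mv (2 ^ K) (2 ^ K)).getD i 0 : ℕ) : ZMod N))).val) := ⟨_, rfl⟩
  rw [← hws] at aREM
  have hwsl : ws.length = 2 ^ K := by rw [hws]; simp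
  have hval : ∀ u, u < 2 ^ K → ws.getD u 0 = apBlockProd s Mv (2 ^ K) u % N := by
    intro u hu; rw [hws]; exact apValues_getD hN hu
  -- stage 3a: `t := 2 · size N`, the flags
  set T0 := ((setc (ρ .ublk) 0 : NCom S V O E)).eval 𝓔 (((setc (ρ .u) 0 : NCom S V O E)).eval 𝓔 (((setc (ρ .flag) 0 : NCom S V O E)).eval 𝓔
    (((add (ρ (.gc .t)) (ρ (.gc .t)) (ρ (.gc .t)) : NCom S V O E)).eval 𝓔 (((sizeOf (ρ (.gc .t)) (ρ .n) : NCom S V O E)).eval 𝓔 Y3)))) with hT0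
  have t0t : T0.sc (ρ (.gc .t)) = 2 * N.size := by simp [hT0, eval, y3n]; ring
  have t0u : T0.sc (ρ .u) = 0 := by simp [hT0, eval]
  have t0flag : T0.sc (ρ .flag) = 0 := by simp [hT0, eval]
  have t0ublk : T0.sc (ρ .ublk) = 0 := by simp [hT0, eval]
  have t0r : ∀ r : ApS, r ≠ .gc .t → r ≠ .flag → r ≠ .u → r ≠ .ublk → T0.sc (ρ r) = Y3.sc (ρ r) := fun r a1 a2 a3 a4 => by
    simp [hT0, eval, a1, a2, a3, a4]
  have t0o : ∀ r, (∀ i, r ≠ ρ i) → T0.sc r = Y3.sc r := fun r hr => by simp [hT0, eval, hr]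
  have t0vi : T0.vi = Y3.vi := by simp [hT0, eval]
  have t0vo : T0.vo = Y3.vo := by simp [hT0, eval]
  have t0pk : T0.peak ≤ max Y3.peak (2 * N.size) := by
    simp only [hT0, eval, NState.peak_bump, NState.peak_setSc, NState.sc_setSc, NState.sc_bump, Function.update_apply, y3n, Nat.max_zero,
      if_true]
    clear * -; omega
  have t0st : T0.steps = Y3.steps + 5 := by simp [hT0, eval]
  have t0n : T0.sc (ρ .n) = N := (t0r .n (by simp) (by simp) (by simp) (by simp)).trans y3n
  have t0d : T0.sc (ρ .d) = 2 ^ K := (t0r .d (by simp) (by simp) (by simp) (by simp)).trans y3d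
  have t0one : T0.sc (ρ .one) = 1 := (t0r .one (by simp) (by simp) (by simp) (by simp)).trans y3one
  have t0REM : T0.vi (ν (.rv .REM)) = ws := by rw [t0vi, aREM]
  have hBLe : ((times (ρ .d) (apBlockBody ρ ν) : NCom S V O E)).eval 𝓔 T0 =
      ((apBlockBody ρ ν : NCom S V O E).eval 𝓔)^[2 ^ K] (T0.bump 0 (2 ^ K + 1)) := by rw [eval_times, t0d]
  clear_value T0
  -- stage 3b: the block scan
  obtain ⟨k1, k2, k3, k4, k5, k6, k7, k8, k9, k10⟩ := apBlock_iterate (𝓔 := 𝓔) ρ ν (T0.bump 0 (2 ^ K + 1)) ws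
      (by simpa using t0REM) (by simpa using t0u) (by simpa using t0one) (by simpa using t0flag) (by simpa using t0ublk)
      (by simp only [NState.sc_bump, t0t, t0n]; exact le_rfl) (2 ^ K) (by rw [hwsl])
  set BL := ((apBlockBody ρ ν : NCom S V O E).eval 𝓔)^[2 ^ K] (T0.bump 0 (2 ^ K + 1)) with hBL
  simp only [NState.sc_bump, NState.vi_bump, NState.vo_bump, NState.peak_bump, NState.steps_bump, Nat.max_zero, t0n] at k1 k2 k3 k4 k5 k6 k7 k8 k9 k10
  rw [← hwsl, List.drop_length] at k1
  clear_value BL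
  -- stage 3c: reset `found`, `kout`, `j`
  set T1 := ((setc (ρ .j) 0 : NCom S V O E)).eval 𝓔 (((setc (ρ .kout) 0 : NCom S V O E)).eval 𝓔 (((setc (ρ .found) 0 : NCom S V O E)).eval 𝓔 BL)) with hT1
  have t1j : T1.sc (ρ .j) = 0 := by simp [hT1, eval]
  have t1kout : T1.sc (ρ .kout) = 0 := by simp [hT1, eval]
  have t1found : T1.sc (ρ .found) = 0 := by simp [hT1, eval]
  have t1r : ∀ r : ApS, r ≠ .j → r ≠ .kout → r ≠ .found → T1.sc (ρ r) = BL.sc (ρ r) := fun r a1 a2 a3 => by simp [hT1, eval, a1, a2, a3]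
  have t1o : ∀ r, (∀ i, r ≠ ρ i) → T1.sc r = BL.sc r := fun r hr => by simp [hT1, eval, hr]
  have t1vi : T1.vi = BL.vi := by simp [hT1, eval]
  have t1vo : T1.vo = BL.vo := by simp [hT1, eval]
  have t1pk : T1.peak = BL.peak := by simp [hT1, eval]
  have t1st : T1.steps = BL.steps + 3 := by simp [hT1, eval]
  -- registers carried through the scan
  have t1c : ∀ r : ApS, r ≠ .j → r ≠ .kout → r ≠ .found → r ≠ .u → r ≠ .flag → r ≠ .ublk → r ≠ .gc .a → r ≠ .gc .b → r ≠ .gc .q → r ≠ .gc .r →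
      r ≠ .gc .t → T1.sc (ρ r) = Y3.sc (ρ r) := fun r a1 a2 a3 a4 a5 a6 a7 a8 a9 a10 a11 => by
    rw [t1r r a1 a2 a3, k5 r a4 a5 a6 a7 a8 a9 a10, t0r r a11 a5 a4 a6]
  have t1n : T1.sc (ρ .n) = N := (t1c .n (by simp) (by simp) (by simp) (by simp) (by simp) (by simp) (by simp) (by simp) (by simp) (by simp) (by simp)).trans y3n
  have t1s : T1.sc (ρ .s) = s := (t1c .s (by simp) (by simp) (by simp) (by simp) (by simp) (by simp) (by simp) (by simp) (by simp) (by simp) (by simp)).trans y3s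
  have t1M : T1.sc (ρ .M) = Mv := (t1c .M (by simp) (by simp) (by simp) (by simp) (by simp) (by simp) (by simp) (by simp) (by simp) (by simp) (by simp)).trans y3M
  have t1K : T1.sc (ρ .K) = K := (t1c .K (by simp) (by simp) (by simp) (by simp) (by simp) (by simp) (by simp) (by simp) (by simp) (by simp) (by simp)).trans y3K
  have t1d : T1.sc (ρ .d) = 2 ^ K := (t1c .d (by simp) (by simp) (by simp) (by simp) (by simp) (by simp) (by simp) (by simp) (by simp) (by simp) (by simp)).trans y3d
  have t1one : T1.sc (ρ .one) = 1 := (t1c .one (by simp) (by simp) (by simp) (by simp) (by simp) (by simp) (by simp) (by simp) (by simp) (by simp) (by simp)).trans y3one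
  have t1ptn : T1.sc (ρ (.pt (.pm .n))) = N := (t1c _ (by simp) (by simp) (by simp) (by simp) (by simp) (by simp) (by simp) (by simp) (by simp) (by simp) (by simp)).trans y3ptn
  have t1rmn : T1.sc (ρ (.rm (.dv (.iv (.pm .n))))) = N :=
    (t1c _ (by simp) (by simp) (by simp) (by simp) (by simp) (by simp) (by simp) (by simp) (by simp) (by simp) (by simp)).trans ri1
  have t1t : T1.sc (ρ (.gc .t)) = 2 * N.size := by
    rw [t1r _ (by simp) (by simp) (by simp), k5 _ (by simp) (by simp) (by simp) (by simp) (by simp) (by simp) (by simp), t0t]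
  have t1flag : T1.sc (ρ .flag) = if (blockFirst N ws (2 ^ K)).isSome then 1 else 0 := by rw [t1r _ (by simp) (by simp) (by simp), k3]
  have t1ublk : T1.sc (ρ .ublk) = (blockFirst N ws (2 ^ K)).getD 0 := by rw [t1r _ (by simp) (by simp) (by simp), k4]
  have t1o' : ∀ r, (∀ i, r ≠ ρ i) → T1.sc r = σ.sc r := fun r hr => by rw [t1o r hr, k6 r hr, t0o r hr, y3o r hr]
  have t1v : ∀ w, w ≠ ν (.rv .REM) → T1.vi w = Y3.vi w := fun w hw => by rw [t1vi, k7 w hw, t0vi]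
  have t1REM : T1.vi (ν (.rv .REM)) = [] := by rw [t1vi, k1]
  have t1vo' : T1.vo = Y3.vo := by rw [t1vo, k8, t0vo]
  have t1pk' : T1.peak ≤ max Y3.peak (max (2 * N.size) (2 ^ K)) := by
    rw [t1pk]; refine k9.trans (max_le (t0pk.trans ?_) ?_)
    · exact max_le (le_max_left _ _) (le_max_of_le_right (le_max_left _ _))
    · exact le_max_of_le_right (le_max_right _ _)
  have t1st' : T1.steps ≤ Y3.steps + 2 ^ K * (10 * N.size + 8) + 2 ^ K + 9 := by
    rw [t1st]; have := k10; rw [t0t, t0st] at this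
    have e1 : 2 ^ K * (5 * (2 * N.size) + 8) = 2 ^ K * (10 * N.size + 8) := by ring
    rw [e1] at this; clear * - this; generalize 2 ^ K = P at *; omega
  clear_value T1
  clear t1r t1o t1vi t1vo t1pk t1st k2 k3 k4 k5 k6 k7 k8 k9 k10 hBL t0t t0u t0flag t0ublk t0r t0o t0vi t0vo t0pk t0st t0REM
  -- `τ` is the last conditional applied to `T1`
  have hτ : τ = ((ifPos (ρ .flag) (times (ρ .d) (apCandBody ρ)) skip : NCom S V O E)).eval 𝓔 T1 := by
    rw [hτ0]; simp only [apStage3, eval_seq]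
    rw [← hT0, hBLe, ← hT1]
  -- the extension calls
  have hext : (apScanP M ρ ν ω : NCom S V O E).extOK 𝓔 σ := by
    simp only [apScanP, extOK_seq]
    exact ⟨xInit, x1, x2, xRem, extOK_of_noExt 𝓔 (by simp [apStage3, apBlockBody, apCandBody, noExt, gcdP_noExt]) _⟩
  -- peak and steps up to `T1`
  have P8 : T1.peak ≤ max σ.peak (apPeakBound N s Mv K) := t1pk'.trans (max_le P7 (le_max_of_le_right (max_le q6c hKB)))
  have S8 : T1.steps + 2 ^ K * (10 * N.size + 12) + 2 ^ K + 2 ≤ σ.steps + apCost M.cost N K := by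
    have := t1st'; clear * - this S7; generalize 2 ^ K = P at *; omega
  -- the standing invariant at `T1` (everything except the scalars of the last scan)
  have I1 : ApInv ρ ν ω N T1 :=
    ⟨t1one, t1ptn, t1rmn,
     (t1v _ (by simp)).trans blvl, (t1v _ (by simp)).trans bpA, (t1v _ (by simp)).trans bpB, (t1v _ (by simp)).trans bpF,
     (t1v _ (by simp)).trans bpG, (t1v _ (by simp)).trans bpH, (t1v _ (by simp)).trans bpC,
     (congrFun t1vo' _).trans bacc, (congrFun t1vo' _).trans baccN, (congrFun t1vo' _).trans baccT,
     (t1v _ (by simp)).trans ri2, (t1v _ (by simp)).trans ri3, (t1v _ (by simp)).trans ri4, (t1v _ (by simp)).trans ri5, (t1v _ (by simp)).trans ri6,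
     (t1v _ (by simp)).trans ri7, (t1v _ (by simp)).trans ri8, (t1v _ (by simp)).trans ri9, (t1v _ (by simp)).trans ri10, (t1v _ (by simp)).trans ri11,
     (t1v _ (by simp)).trans ri12,
     (congrFun t1vo' _).trans ri13, (congrFun t1vo' _).trans ri14, (congrFun t1vo' _).trans ri15, (congrFun t1vo' _).trans ri16,
     (congrFun t1vo' _).trans raccR,
     (t1v _ (by simp)).trans ri17, (t1v _ (by simp)).trans ri18⟩
  have V1 : T1.vi (ν (.pv .vals)) = [] ∧ T1.vi (ν (.pv .tree)) = [] ∧ T1.vi (ν (.rv .REM)) = [] ∧ T1.vi (ν (.rv .TREE)) = [] ∧ T1.vi (ν (.rv .GIN)) = [] :=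
    ⟨(t1v _ (by simp)).trans avals, (t1v _ (by simp)).trans atree, t1REM, (t1v _ (by simp)).trans aTREE, (t1v _ (by simp)).trans aGIN⟩
  have F1 : (∀ w, (∀ i, w ≠ ν i) → T1.vi w = σ.vi w) ∧ (∀ p, (∀ i, p ≠ ω i) → T1.vo p = σ.vo p) ∧ (∀ r, (∀ i, r ≠ ρ i) → T1.sc r = σ.sc r) :=
    ⟨fun w hw => (t1v w (hw _)).trans (y3w w hw), fun p hp => (congrFun t1vo' p).trans (y3p p hp), t1o'⟩
  -- the least candidate
  obtain ⟨hnone, hsome⟩ := apScan_least (N := N) (s := s) (M := Mv) (d := 2 ^ K) hN.le hpow hwsl hval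
  rcases hbf : blockFirst N ws (2 ^ K) with _ | u0
  · -- no block is hit: `found = 0`
    rw [hbf] at t1flag
    simp only [Option.isSome_none, Bool.false_eq_true, if_false] at t1flag
    have hτ' : τ = T1.bump 0 1 := by rw [hτ, eval_ifPos_zero 𝓔 _ _ t1flag]; rfl
    rw [hτ']
    simp only [NState.sc_bump, NState.vi_bump, NState.vo_bump, NState.peak_bump, NState.steps_bump, Nat.max_zero]
    refine ⟨Or.inl t1found, fun h => ?_, fun _ => hnone hbf, ?_, t1n, t1s, t1M, t1K, V1.1, V1.2.1, V1.2.2.1, V1.2.2.2.1, V1.2.2.2.2, F1.1, F1.2.1, F1.2.2,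
      P8, ?_, hext⟩
    · rw [t1found] at h; exact absurd h (by decide)
    · exact I1.bump ρ ν ω 0 1
    · clear * - S8; generalize 2 ^ K = P at *; omega
  · -- block `u0` is hit: the candidate scan finds the least `k`
    rw [hbf] at t1flag t1ublk
    simp only [Option.isSome_some, if_true] at t1flag
    simp only [Option.getD_some] at t1ublk
    have hu0 : u0 < 2 ^ K := by
      have := hbf; rw [blockFirst, find?_range_eq_some] at this; exact this.1
    obtain ⟨j0, hj0, hk1, hk2, hhit, hleast⟩ := hsome u0 hbf
    have hτ' : τ = ((apCandBody ρ : NCom S V O E).eval 𝓔)^[2 ^ K] ((T1.bump 0 1).bump 0 (2 ^ K + 1)) := by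
      rw [hτ, eval_ifPos_pos 𝓔 _ _ (by rw [t1flag]; exact Nat.one_pos), eval_times]
      simp only [NState.sc_bump, t1d]
    obtain ⟨g1, g2, g3, g4, g5, g6, g7, g8, g9⟩ := apCand_iterate (𝓔 := 𝓔) ρ ((T1.bump 0 1).bump 0 (2 ^ K + 1))
      (by simpa using t1j) (by simpa using t1one) (by simpa using t1found) (by simpa using t1kout)
      (by simp only [NState.sc_bump, t1t, t1n]; exact le_rfl) (2 ^ K)
    rw [← hτ'] at g1 g2 g3 g4 g5 g6 g7 g8 g9
    simp only [NState.sc_bump, NState.vi_bump, NState.vo_bump, NState.peak_bump, NState.steps_bump, Nat.max_zero, t1n, t1s, t1M, t1ublk, t1d, hj0,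
      Option.isSome_some, if_true, Option.map_some, Option.getD_some, t1t] at g1 g2 g3 g4 g5 g6 g7 g8 g9
    have gr : ∀ r : ApS, r ≠ .j → r ≠ .tmp → r ≠ .found → r ≠ .kout → r ≠ .gc .a → r ≠ .gc .b → r ≠ .gc .q → r ≠ .gc .r → τ.sc (ρ r) = T1.sc (ρ r) :=
      fun r a1 a2 a3 a4 a5 a6 a7 a8 => g4 r a1 a2 a3 a4 a5 a6 a7 a8
    refine ⟨Or.inr g2, fun _ => ?_, fun h => ?_, ?_, (gr .n (by simp) (by simp) (by simp) (by simp) (by simp) (by simp) (by simp) (by simp)).trans t1n,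
      (gr .s (by simp) (by simp) (by simp) (by simp) (by simp) (by simp) (by simp) (by simp)).trans t1s,
      (gr .M (by simp) (by simp) (by simp) (by simp) (by simp) (by simp) (by simp) (by simp)).trans t1M,
      (gr .K (by simp) (by simp) (by simp) (by simp) (by simp) (by simp) (by simp) (by simp)).trans t1K,
      (congrFun g6 _).trans V1.1, (congrFun g6 _).trans V1.2.1, (congrFun g6 _).trans V1.2.2.1, (congrFun g6 _).trans V1.2.2.2.1, (congrFun g6 _).trans V1.2.2.2.2,
      fun w hw => (congrFun g6 w).trans (F1.1 w hw), fun p hp => (congrFun g7 p).trans (F1.2.1 p hp), fun r hr => (g5 r hr).trans (F1.2.2 r hr),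
      ?_, ?_, hext⟩
    · rw [g3]; exact ⟨hk1, hk2, hhit, hleast⟩
    · rw [g2] at h; exact absurd h (by decide)
    · obtain ⟨f1, f2, f3, f4, f5, f6, f7, f8, f9, f10, f11, f12, f13, f14, f15, f16, f17, f18, f19, f20, f21, f22, f23, f24, f25, f26, f27, f28, f29, f30, f31⟩ := I1
      exact ⟨(gr .one (by simp) (by simp) (by simp) (by simp) (by simp) (by simp) (by simp) (by simp)).trans f1,
        (gr _ (by simp) (by simp) (by simp) (by simp) (by simp) (by simp) (by simp) (by simp)).trans f2,
        (gr _ (by simp) (by simp) (by simp) (by simp) (by simp) (by simp) (by simp) (by simp)).trans f3,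
        (congrFun g6 _).trans f4, (congrFun g6 _).trans f5, (congrFun g6 _).trans f6, (congrFun g6 _).trans f7, (congrFun g6 _).trans f8,
        (congrFun g6 _).trans f9, (congrFun g6 _).trans f10, (congrFun g7 _).trans f11, (congrFun g7 _).trans f12, (congrFun g7 _).trans f13,
        (congrFun g6 _).trans f14, (congrFun g6 _).trans f15, (congrFun g6 _).trans f16, (congrFun g6 _).trans f17, (congrFun g6 _).trans f18,
        (congrFun g6 _).trans f19, (congrFun g6 _).trans f20, (congrFun g6 _).trans f21, (congrFun g6 _).trans f22, (congrFun g6 _).trans f23,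
        (congrFun g6 _).trans f24, (congrFun g7 _).trans f25, (congrFun g7 _).trans f26, (congrFun g7 _).trans f27, (congrFun g7 _).trans f28,
        (congrFun g7 _).trans f29, (congrFun g6 _).trans f30, (congrFun g6 _).trans f31⟩
    · refine g8.trans (max_le P8 (le_max_of_le_right ?_))
      have := q1 u0 hu0
      clear * - this; generalize 2 ^ K = P at *; omega
    · have := g9
      have e7 : 2 ^ K * (5 * (2 * N.size) + 12) = 2 ^ K * (10 * N.size + 12) := by ring
      rw [e7] at this
      clear * - this S8; generalize 2 ^ K = P at *; omega


/-- **Harvey 2021, Prop. 2.5 (Pollard–Strassen) on the numeric register machine**: run with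
`s = 0`, `M = 1`, the scan reports `found = 1` exactly when the least prime factor of `N` is at
most `d² = 4^K`, and then `kout = minFac N`. [cite: Harvey2021, Prop. 2.5 (arXiv Prop. 6)] -/
theorem apScanP_minFac (σ : NState S V O) (N K : ℕ) (hN : 1 < N) (hodd : Odd N) (hI : ApInv ρ ν ω N σ)
    (hn : σ.sc (ρ .n) = N) (hs : σ.sc (ρ .s) = 0) (hM : σ.sc (ρ .M) = 1) (hK : σ.sc (ρ .K) = K)
    (hvals : σ.vi (ν (.pv .vals)) = []) (htree : σ.vi (ν (.pv .tree)) = []) (hREM : σ.vi (ν (.rv .REM)) = []) (hTREE : σ.vi (ν (.rv .TREE)) = [])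
    (hGIN : σ.vi (ν (.rv .GIN)) = []) :
    let τ := (apScanP M ρ ν ω : NCom S V O E).eval 𝓔 σ
    (τ.sc (ρ .found) = 1 → τ.sc (ρ .kout) = N.minFac ∧ N.minFac ≤ 2 ^ K * 2 ^ K) ∧
      (τ.sc (ρ .found) = 0 → 2 ^ K * 2 ^ K < N.minFac) := by
  intro τ
  obtain ⟨-, h1, h0, -⟩ := apScanP_spec M ρ ν ω σ N 0 1 K hN hodd hI hn hs hM hK hvals htree hREM hTREE hGIN
  have hc : ∀ k, apCand 0 1 k = k := fun k => by simp [apCand]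
  simp only [hc] at h1 h0
  refine ⟨fun hf => ?_, fun hf => ?_⟩
  · obtain ⟨hk1, hk2, hg, hleast⟩ := h1 hf
    have := minFac_eq_of_least (N := N) (by omega) hk1 hg hleast
    exact ⟨this, this ▸ hk2⟩
  · by_contra hle
    push Not at hle
    have hmf := Nat.minFac_prime (show N ≠ 1 by omega)
    have hg : 1 < Nat.gcd N.minFac N := by
      rw [Nat.gcd_eq_left (Nat.minFac_dvd N)]; exact hmf.one_lt
    exact absurd (h0 hf N.minFac hmf.one_lt.le hle) (by omega)

end ApSpec

end NCom

end Literature.Computability.Complexity
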